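import Literature.ModelTheory.ExponentialFields.RealExpLagrange
import Mathlib.LinearAlgebra.Matrix.Rank
import Mathlib.LinearAlgebra.Matrix.NonsingularInverse
import Mathlib.ModelTheory.Skolem
import Mathlib.Analysis.Calculus.ImplicitContDiff
import Mathlib.Analysis.Calculus.MeanValue
import HarnessLib

/-!
# Wilkie 1989: Lemma 3 from Lemma 1 (zero sets of exponential terms contain e.a. points), and §2 by transfer

Trunk `TranscendEllArithS`, family `periods` (periods.S28): the third layer of the decomposition
of the named fact `Literature.ModelTheory.ExponentialFields.wilkie_isModelComplete` (`RealExpField.lean`), refining the leaf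
`Literature.ModelTheory.ExponentialFields.Wilkie1989_lemma3` of `Wilkie1989.lean` along A. J. Wilkie, *On the theory of the real
exponential field*, Illinois J. Math. 33 (1989), §3–§4 (pp. 390–398).

* §3, p. 390: for exponential terms `f₁, …, fₚ ∈ k[x̄]ᵉ`, the zero set ("variety")
  `V(f₁, …, fₚ) = {ᾱ ∈ Kⁿ : fᵢ(ᾱ) = 0, i = 1, …, p}` (`RealExpModel.zeroSet`) and its non-singular
  part `Vⁿˢ(f₁, …, fₚ) = {ᾱ ∈ V(f₁, …, fₚ) : (df₁ ∧ ⋯ ∧ dfₚ)(ᾱ) ≠ 0}`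
  (`RealExpModel.nonsingularZeroSet`; `(df₁ ∧ ⋯ ∧ dfₚ)(ᾱ) ≠ 0` says that some `p × p` minor of
  the Jacobian is nonzero (p. 386), i.e. that the rows `∇f₁(ᾱ), …, ∇fₚ(ᾱ)` are linearly
  independent: `linearIndependent_rows_iff_exists_det_submatrix_ne_zero`, proved).
* §3, p. 391: "`g` vanishes on `U ∩ V(f₁, …, fₚ)` for some neighbourhood `U` of `ᾱ` in `Kⁿ`, a
  property we shall usually refer to by saying *`g` vanishes on `V(f₁, …, fₚ)` close to `ᾱ`*"
  (`RealExpModel.VanishesCloseTo`; neighbourhoods are the balls `Σ (aᵢ - qᵢ)² < β`, `β ∈ K`,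
  `β > 0`, of p. 388).
* **Lemma 1** (p. 391), clauses (2) and (3), under Wilkie's standing assumption "Let us suppose
  that `k` is countable" (p. 391): vendored as the named fact `Literature.ModelTheory.ExponentialFields.Wilkie1989_lemma1` (its
  proof, pp. 391–395, is an induction over a tower `k[x̄] = M₀ ⊆ M₁ ⊆ ⋯` exhausting `k[x̄]ᵉ`;
  clause (1), on the ranks of the `hᵢ` in that tower, is internal to the induction and omitted).
* **Lemma 3** (p. 396: "Suppose `F ∈ k[x̄]ᵉ` and `V(F) ≠ ∅`. Then `V(F)` contains an e.a. point
  of `Kⁿ` over `k`") is **proved from Lemma 1** (`Literature.ModelTheory.ExponentialFields.Wilkie1989_lemma3_of_lemma1`), following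
  the printed proof (pp. 396–398) step by step:
  the reduction "we may clearly suppose `k` countable" (downward Löwenheim–Skolem, an elementary
  substructure of `k` containing the parameters of `F`); `h₁, …, hₚ` from Lemma 1 for `S = V(F)`;
  if `p = n` the point of clause (2) is e.a.; if `p < n`: a nonzero coefficient `f` of
  `dh₁ ∧ ⋯ ∧ dhₚ` at `ᾱ` (a `p × p` Jacobian minor, as a term: `ExpTerm.det`),
  `hₚ₊₁ = xₙ₊₁·f - 1` and (∗) `V(h₁, …, hₚ₊₁) = Vⁿˢ(h₁, …, hₚ₊₁)`
  (`linearIndependent_grad_liftSys`), the point of `V(h₁, …, hₚ₊₁, F)` at minimal distance from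
  `(η̄, 0)` (`RealExpModel.exists_isMinOn_sqDist`, by transfer), the local minimum of the
  distance on `V(h₁, …, hₚ₊₁)` obtained from clause (3), the Lagrange condition
  "(by Section 2) `(ω ∧ dD_η)(γ) = 0`" (`RealExpModel.not_linearIndependent_gradRows_of_isLocalMin`,
  by transfer), the term `G = F² + f⁶·(sum of squares of the coefficients of `ω ∧ dD_η`)`
  (`lagTerm`, `iterTerm`) and the iteration over `η̄ = 0̄, e₁, …, eₙ` producing a point where
  `(ω ∧ dxᵢ)(γ) = 0` for all `i` (`exists_point_allLag`), contradicting `p < n` and `ω(γ) ≠ 0`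
  (`(∗∗)` of p. 395).

The new DAG below `Literature.ModelTheory.ExponentialFields.wilkie_isModelComplete` is therefore
`Wilkie1989_lemma3 ⇐ Wilkie1989_lemma1` (this file, proved); `Wilkie1989_lemma1` is proved in
`Wilkie1989Lemma3Proofs.lean` (`Literature.ModelTheory.ExponentialFields.Wilkie1989_lemma1_holds`), using Part II of this file.

## Mathlib search

Mathlib has `Matrix.rank`, `Matrix.linearIndependent_rows_iff_isUnit`,
`exists_linearIndependent'`, `linearIndependent_finSnoc`, the downward Löwenheim–Skolem theorem
`FirstOrder.Language.exists_elementarySubstructure_card_eq`; it has no characterization of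
independent rows by maximal minors and nothing on exponential varieties.

## Design choices

* As in `Wilkie1989.lean`, terms stand for the elements of `k[x̄]ᵉ`, bundled models
  `Theory.ModelType.{0, 0, 0} realExpTheory` for `k, K ⊨ T`, embeddings `f : k ↪ K` for `k ⊆ K`.
  The zero sets, non-singular zero sets and "vanishing close to" are defined for arbitrary
  parameter assignments `a : κ → K` (used with `a = f`).
* `(dh₁ ∧ ⋯ ∧ dhₚ)(ᾱ) ≠ 0` is rendered as linear independence of the gradient rows; the
  equivalence with the non-vanishing of a `p × p` minor (the coefficients of the `p`-form,
  p. 386) is proved (`linearIndependent_rows_iff_exists_det_submatrix_ne_zero`) and used to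
  produce the term `f` of p. 396.

## References

* A. J. Wilkie, *On the theory of the real exponential field*, Illinois J. Math. 33 (1989),
  384–408: §2 (p. 390), §3 (pp. 390–395, Lemma 1), §4 (pp. 396–398, Lemma 3).

## Part II — §2: functions with vanishing wedge are locally constant on a variety (by transfer)

§2 of the paper ("Transfer", pp. 387–390) works in a model `K` of `T = Th(ℝ_exp)` and derives,
from the implicit function theorem "by transfer", the following criterion (p. 390, "To sum up"):
for `f₁, …, fₚ ∈ k(x̄)ᵉ` (`p < n`) vanishing at `ᾱ` with `(df₁ ∧ ⋯ ∧ dfₚ)(ᾱ) ≠ 0` and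
`g ∈ k(x̄)ᵉ` defined near `ᾱ`, the `(p+1)`-form `df₁ ∧ ⋯ ∧ dfₚ ∧ dg` vanishes on
`(U × U') ∩ V(f₁, …, fₚ)` (a neighbourhood of `ᾱ` in the zero set) **iff** `g` is constant on
this set.  This file **proves** both directions in every model of `T_exp`, for `g = t/a₀` a
quotient of exponential terms (`a₀(ᾱ) ≠ 0`; the wedge condition multiplied out by `a₀²`:
`df̄ ∧ (a₀ dt - t da₀)`), neighbourhoods being the balls `Σ (xᵢ - αᵢ)² < ε` of p. 388:

* `Literature.ModelTheory.ExponentialFields.RealExpModel.eqOn_closeTo_of_wedge_vanishes` (**wedge vanishes near `ᾱ` ⇒ `t/a₀` constant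
  near `ᾱ` on the variety**; real input: the implicit function theorem
  (`ImplicitFunctionData`, `ImplicitFunctionData.contDiffAt_implicitFunction`) and the mean value
  theorem (`Convex.is_const_of_fderivWithin_eq_zero`), packaged in the coordinate-free lemma
  `Real.eventually_eq_of_fderiv_comp_ker`; then transfer of the first-order formula
  `wedgeFormula`);
* `Literature.ModelTheory.ExponentialFields.RealExpModel.not_linearIndependent_of_vanishesCloseTo` (**`t` vanishes near `ᾱ` on the
  variety ⇒ `(df̄ ∧ dt)(ᾱ) = 0`**, from the Lagrange multiplier theorem by transfer,
  `RealExpLagrange.lean`);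
* `Literature.ModelTheory.ExponentialFields.RealExpModel.exists_ball_ne_zero` (**continuity by transfer**, p. 393: "`aₛ(β̄') ≠ 0` and
  hence (by transfer) `aₛ` is non-zero throughout some sufficiently small neighbourhood of `β̄'`");
* `Literature.ModelTheory.ExponentialFields.RealExpModel.realize_termPDeriv_congr` (**`∂/∂xᵢ` respects the equivalence of terms**,
  p. 385: "It can be shown (see [4]) that `∂/∂xᵢ` respects the equivalence relation"; here for
  equality of the functions on `Kⁿ`, by transfer).

## References (Part II)

* A. J. Wilkie, *On the theory of the real exponential field*, Illinois J. Math. 33 (1989),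
  384–408: §1 p. 385, §2 pp. 387–390, p. 393.
-/

noncomputable section

open FirstOrder FirstOrder.Language FirstOrder.Language.Structure

namespace Literature.ModelTheory.ExponentialFields

namespace RealExpModel

/-! ### Linear algebra: independent rows and maximal minors -/

section LinearAlgebra

variable {F : Type*} [Field F] {p n : ℕ}

/-- If some `p × p` minor of a `p × n` matrix is nonzero then its rows are linearly independent.
[folklore] -/
theorem linearIndependent_rows_of_det_submatrix_ne_zero (A : Matrix (Fin p) (Fin n) F)
    (I : Fin p → Fin n) (h : (A.submatrix _root_.id I).det ≠ 0) :
    LinearIndependent F (fun i => A i) := by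
  have hu : IsUnit (A.submatrix _root_.id I) :=
    (Matrix.isUnit_iff_isUnit_det _).2 (isUnit_iff_ne_zero.2 h)
  have hrows : LinearIndependent F (A.submatrix _root_.id I).row :=
    Matrix.linearIndependent_rows_iff_isUnit.2 hu
  have e : (A.submatrix _root_.id I).row = (LinearMap.funLeft F F I) ∘ (fun i => A i) := by
    funext i; rfl
  rw [e] at hrows
  exact hrows.of_comp _

/-- If the rows of a `p × n` matrix over a field are linearly independent then some `p × p` minor
(with distinct columns) is nonzero. [folklore] -/
theorem exists_det_submatrix_ne_zero_of_linearIndependent_rows (A : Matrix (Fin p) (Fin n) F)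
    (h : LinearIndependent F (fun i => A i)) :
    ∃ I : Fin p → Fin n, Function.Injective I ∧ (A.submatrix _root_.id I).det ≠ 0 := by
  classical
  obtain ⟨κ', a, ha, hspan, hli⟩ := exists_linearIndependent' (K := F) A.col
  haveI : Fintype κ' := Fintype.ofInjective a ha
  have hcard : Fintype.card κ' = p := by
    have h1 : Module.finrank F (Submodule.span F (Set.range (A.col ∘ a))) = Fintype.card κ' :=
      finrank_span_eq_card hli
    have h2 : A.rank = p := by
      have := LinearIndependent.rank_matrix (M := A) h
      simpa using this
    rw [hspan, ← Matrix.rank_eq_finrank_span_cols, h2] at h1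
    exact h1.symm
  obtain ⟨e⟩ : Nonempty (Fin p ≃ κ') := ⟨(Fintype.equivFinOfCardEq hcard).symm⟩
  refine ⟨a ∘ e, ha.comp e.injective, ?_⟩
  have hcols : LinearIndependent F (A.submatrix _root_.id (a ∘ e)).col := by
    have e1 : (A.submatrix _root_.id (a ∘ e)).col = (A.col ∘ a) ∘ e := by
      funext j; rfl
    rw [e1]
    exact hli.comp _ e.injective
  have hu := Matrix.linearIndependent_cols_iff_isUnit.1 hcols
  rw [Matrix.isUnit_iff_isUnit_det, isUnit_iff_ne_zero] at hu
  exact hu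

/-- **Independent rows and maximal minors.** The rows of a `p × n` matrix over a field are
linearly independent iff some `p × p` minor is nonzero; for a Jacobian matrix this is the
equivalence between "`(df₁ ∧ ⋯ ∧ dfₚ)(ᾱ) ≠ 0`" (some coefficient of the `p`-form is nonzero,
Wilkie 1989, p. 386) and the linear independence of `∇f₁(ᾱ), …, ∇fₚ(ᾱ)` (p. 390). [folklore] -/
theorem linearIndependent_rows_iff_exists_det_submatrix_ne_zero (A : Matrix (Fin p) (Fin n) F) :
    LinearIndependent F (fun i => A i) ↔ ∃ I : Fin p → Fin n, (A.submatrix _root_.id I).det ≠ 0 :=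
  ⟨fun h => let ⟨I, _, hI⟩ := exists_det_submatrix_ne_zero_of_linearIndependent_rows A h; ⟨I, hI⟩,
    fun ⟨I, hI⟩ => linearIndependent_rows_of_det_submatrix_ne_zero A I hI⟩

/-- If every coordinate vector of `Fⁿ` lies in the span of `p` vectors then `n ≤ p`. [folklore] -/
theorem card_le_of_forall_single_mem_span {v : Fin p → Fin n → F}
    (h : ∀ i : Fin n, (Pi.single i 1 : Fin n → F) ∈ Submodule.span F (Set.range v)) : n ≤ p := by
  classical
  have htop : Submodule.span F (Set.range v) = ⊤ := by
    rw [eq_top_iff, ← (Pi.basisFun F (Fin n)).span_eq, Submodule.span_le]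
    rintro x ⟨i, rfl⟩
    simpa using h i
  have h1 : Module.finrank F (Submodule.span F (Set.range v)) ≤ p := by
    simpa [Set.finrank] using finrank_range_le_card (R := F) v
  rw [htop, finrank_top, Module.finrank_fin_fun] at h1
  exact h1

end LinearAlgebra

/-! ### Zero sets, non-singular zero sets, local vanishing (Wilkie 1989, §3) -/

section ZeroSets

variable {K : Language.Theory.ModelType.{0, 0, 0} realExpTheory} {κ : Type} {n p : ℕ}

/-- The **zero set** ("variety", Wilkie 1989, §3, p. 390)
`V(h₁, …, hₚ) = {ᾱ ∈ Kⁿ : hᵢ(ᾱ) = 0 for i = 1, …, p}` of exponential terms with parameters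
(values `a`). [cite: Wilkie1989, §3, p. 390] -/
def zeroSet (h : Fin p → Language.orderedExpRing.Term (κ ⊕ Fin n)) (a : κ → K) :
    Set (Fin n → K) :=
  {α | ∀ r, (h r).realize (Sum.elim a α) = 0}

/-- Membership in the zero set. [folklore] -/
@[simp] theorem mem_zeroSet {h : Fin p → Language.orderedExpRing.Term (κ ⊕ Fin n)} {a : κ → K}
    {α : Fin n → K} : α ∈ zeroSet h a ↔ ∀ r, (h r).realize (Sum.elim a α) = 0 := Iff.rfl

/-- The **non-singular zero set** (Wilkie 1989, §3, p. 390)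
`Vⁿˢ(h₁, …, hₚ) = {ᾱ ∈ V(h₁, …, hₚ) : (dh₁ ∧ ⋯ ∧ dhₚ)(ᾱ) ≠ 0}`: the common zeros at which the
gradient rows `∇h₁(ᾱ), …, ∇hₚ(ᾱ)` (formal partial derivatives, p. 385) are linearly independent
over `K`, equivalently some `p × p` minor of the Jacobian is nonzero (p. 386;
`linearIndependent_rows_iff_exists_det_submatrix_ne_zero`). [cite: Wilkie1989, §3, p. 390] -/
def nonsingularZeroSet (h : Fin p → Language.orderedExpRing.Term (κ ⊕ Fin n)) (a : κ → K) :
    Set (Fin n → K) :=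
  {α | α ∈ zeroSet h a ∧ LinearIndependent K (fun r => grad (h r) a α)}

/-- Membership in the non-singular zero set. [folklore] -/
theorem mem_nonsingularZeroSet {h : Fin p → Language.orderedExpRing.Term (κ ⊕ Fin n)}
    {a : κ → K} {α : Fin n → K} :
    α ∈ nonsingularZeroSet h a ↔ α ∈ zeroSet h a ∧ LinearIndependent K (fun r => grad (h r) a α) :=
  Iff.rfl

/-- "`g` **vanishes on `V(h₁, …, hₚ)` close to `β`**" (Wilkie 1989, §3, p. 391): `g` vanishes on
`U ∩ V(h₁, …, hₚ)` for some neighbourhood `U` of `β` in `Kⁿ`, neighbourhoods being the balls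
`{q̄ ∈ Kⁿ : Σᵢ (qᵢ - βᵢ)² < ε}`, `ε ∈ K`, `ε > 0` (p. 388). [cite: Wilkie1989, §3, p. 391] -/
def VanishesCloseTo (g : Language.orderedExpRing.Term (κ ⊕ Fin n))
    (h : Fin p → Language.orderedExpRing.Term (κ ⊕ Fin n)) (a : κ → K) (β : Fin n → K) : Prop :=
  ∃ ε : K, 0 < ε ∧ ∀ α : Fin n → K, ∑ j, (α j - β j) ^ 2 < ε → α ∈ zeroSet h a →
    g.realize (Sum.elim a α) = 0

/-- For a square system, a point of the non-singular zero set is an exponential-algebraic point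
(the Jacobian determinant is nonzero iff the rows are independent). [folklore] -/
theorem isExpAlgebraicPointOver_of_mem_nonsingularZeroSet
    {k : Language.Theory.ModelType.{0, 0, 0} realExpTheory} (f : k ↪[Language.orderedExpRing] K)
    {h : Fin n → Language.orderedExpRing.Term (k ⊕ Fin n)} {α : Fin n → K}
    (hα : α ∈ nonsingularZeroSet h f) : IsExpAlgebraicPointOver f α := by
  refine ⟨h, hα.1, ?_⟩
  have hu : IsUnit (jacobian h f α) := by
    rw [← Matrix.linearIndependent_rows_iff_isUnit]
    exact hα.2
  rw [Matrix.isUnit_iff_isUnit_det, isUnit_iff_ne_zero] at hu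
  exact hu

end ZeroSets

/-! ### Semantic lemmas on formal partial derivatives -/

section DerivLemmas

variable {M : Type*} [Language.orderedExpRing.Structure M] [Field M] [LinearOrder M]
  [LawfulStructure M] {κ : Type} {ι ι' : Type} [DecidableEq ι] [DecidableEq ι']

/-- A term all of whose variables are parameters has vanishing formal partial derivatives
(semantically). [folklore] -/
theorem realize_termPDeriv_relabel_inl (i : ι) (t : Language.orderedExpRing.Term κ)
    (v : κ ⊕ ι → M) :
    (termPDeriv i (t.relabel Sum.inl : Language.orderedExpRing.Term (κ ⊕ ι))).realize v = 0 := by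
  induction t with
  | var c => simp [Term.relabel]
  | func g ts ih =>
    cases g with
    | add => simp [Term.relabel, termPDeriv, ih]
    | mul => simp [Term.relabel, termPDeriv, ih]
    | neg => simp [Term.relabel, termPDeriv, ih]
    | zero => simp [Term.relabel, termPDeriv]
    | one => simp [Term.relabel, termPDeriv]
    | exp => simp [Term.relabel, termPDeriv, ih]

/-- Chain rule for an injective renaming of variables `e : ι → ι'` (semantic form): the partial
derivative of the renamed term along a renamed variable `e j` is the renamed partial derivative.
[folklore] -/
theorem realize_termPDeriv_relabel_of_injective {e : ι → ι'} (he : Function.Injective e) (j : ι)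
    (t : Language.orderedExpRing.Term (κ ⊕ ι)) (v : κ ⊕ ι' → M) :
    (termPDeriv (e j) (t.relabel (Sum.map _root_.id e))).realize v =
      (termPDeriv j t).realize (v ∘ Sum.map _root_.id e) := by
  induction t with
  | var x =>
    rcases x with c | i
    · simp [Term.relabel, termPDeriv]
    · by_cases hij : i = j
      · subst hij; simp [Term.relabel, termPDeriv]
      · have : e i ≠ e j := fun h => hij (he h)
        simp [Term.relabel, termPDeriv, hij, this]
  | func g ts ih =>
    cases g with
    | add => simp [Term.relabel, termPDeriv, ih]
    | mul => simp [Term.relabel, termPDeriv, ih, Term.realize_relabel]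
    | neg => simp [Term.relabel, termPDeriv, ih]
    | zero => simp [Term.relabel, termPDeriv]
    | one => simp [Term.relabel, termPDeriv]
    | exp =>
      simp [Term.relabel, termPDeriv, ih, Term.realize_relabel, ExpTerm.realize_termExp_eq_funMap]

omit [DecidableEq ι] in
/-- A renamed term does not depend on the variables outside the range of the renaming: the
corresponding partial derivatives vanish (semantically). [folklore] -/
theorem realize_termPDeriv_relabel_of_not_mem_range {e : ι → ι'} (i : ι') (hi : i ∉ Set.range e)
    (t : Language.orderedExpRing.Term (κ ⊕ ι)) (v : κ ⊕ ι' → M) :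
    (termPDeriv i (t.relabel (Sum.map _root_.id e))).realize v = 0 := by
  induction t with
  | var x =>
    rcases x with c | j
    · simp [Term.relabel]
    · have : e j ≠ i := fun h => hi ⟨j, h⟩
      simp [Term.relabel, termPDeriv, this]
  | func g ts ih =>
    cases g with
    | add => simp [Term.relabel, termPDeriv, ih]
    | mul => simp [Term.relabel, termPDeriv, ih]
    | neg => simp [Term.relabel, termPDeriv, ih]
    | zero => simp [Term.relabel, termPDeriv]
    | one => simp [Term.relabel, termPDeriv]
    | exp => simp [Term.relabel, termPDeriv, ih]

/-- Formal partial derivatives commute with finite sums (semantically). [folklore] -/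
theorem realize_termPDeriv_sum (i : ι) {m : ℕ} (t : Fin m → Language.orderedExpRing.Term (κ ⊕ ι))
    (v : κ ⊕ ι → M) :
    (termPDeriv i (ExpTerm.sum t)).realize v = ∑ l, (termPDeriv i (t l)).realize v := by
  induction m with
  | zero =>
    show (termPDeriv i (0 : Language.orderedExpRing.Term (κ ⊕ ι))).realize v = _
    simp
  | succ m ih =>
    show (termPDeriv i (t 0 + ExpTerm.sum fun l => t l.succ)).realize v = _
    rw [termPDeriv_add, ExpTerm.realize_add, ih, Fin.sum_univ_succ]

/-- The gradient of the squared distance: `∂/∂xⱼ Σᵢ (xᵢ - cᵢ)² = 2 (xⱼ - cⱼ)`. [folklore] -/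
theorem realize_termPDeriv_sqDist {m : ℕ} (c : Fin m → Language.orderedExpRing.Term κ)
    (a : κ → M) (x : Fin m → M) (j : Fin m) :
    (termPDeriv j (sqDist c)).realize (Sum.elim a x) = 2 * (x j - (c j).realize a) := by
  rw [sqDist, realize_termPDeriv_sum]
  have : ∀ l : Fin m, (termPDeriv j ((var (Sum.inr l) + -(c l).relabel Sum.inl) *
      (var (Sum.inr l) + -(c l).relabel Sum.inl) :
        Language.orderedExpRing.Term (κ ⊕ Fin m))).realize (Sum.elim a x) =
      if l = j then 2 * (x j - (c j).realize a) else 0 := by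
    intro l
    simp only [termPDeriv_mul, termPDeriv_add, termPDeriv_neg, ExpTerm.realize_add,
      ExpTerm.realize_mul, ExpTerm.realize_neg, Term.realize_var, Sum.elim_inr,
      realize_termPDeriv_relabel_inl, Term.realize_relabel, Sum.elim_comp_inl]
    simp only [termPDeriv]
    split_ifs with h
    · subst h; simp; ring
    · simp
  simp_rw [this]
  simp

end DerivLemmas

/-! ### Adding the variable `xₙ₊₁` and the equation `xₙ₊₁ · f - 1 = 0` (p. 396) -/

section Lift

variable {K : Language.Theory.ModelType.{0, 0, 0} realExpTheory} {κ : Type} {n p : ℕ}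

/-- A term in `x₁, …, xₙ` regarded as a term in `x₁, …, xₙ, xₙ₊₁`. [folklore] -/
def liftTerm (t : Language.orderedExpRing.Term (κ ⊕ Fin n)) :
    Language.orderedExpRing.Term (κ ⊕ Fin (n + 1)) :=
  t.relabel (Sum.map _root_.id Fin.castSucc)

/-- Realization of a lifted term at `(β, y)`. [folklore] -/
@[simp] theorem realize_liftTerm (t : Language.orderedExpRing.Term (κ ⊕ Fin n)) (a : κ → K)
    (β : Fin n → K) (y : K) :
    (liftTerm t).realize (Sum.elim a (Fin.snoc β y : Fin (n + 1) → K)) = t.realize (Sum.elim a β) := by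
  rw [liftTerm, Term.realize_relabel]
  congr 1
  funext x
  rcases x with c | j <;> simp

/-- Partial derivatives of a lifted term along the old variables. [folklore] -/
@[simp] theorem realize_termPDeriv_castSucc_liftTerm (t : Language.orderedExpRing.Term (κ ⊕ Fin n))
    (a : κ → K) (β : Fin n → K) (y : K) (j : Fin n) :
    (termPDeriv (Fin.castSucc j) (liftTerm t)).realize (Sum.elim a (Fin.snoc β y : Fin (n + 1) → K)) =
      (termPDeriv j t).realize (Sum.elim a β) := by
  rw [liftTerm, realize_termPDeriv_relabel_of_injective (Fin.castSucc_injective n)]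
  congr 1
  funext x
  rcases x with c | i <;> simp

/-- A lifted term does not depend on `xₙ₊₁`. [folklore] -/
@[simp] theorem realize_termPDeriv_last_liftTerm (t : Language.orderedExpRing.Term (κ ⊕ Fin n))
    (a : κ → K) (w : Fin (n + 1) → K) :
    (termPDeriv (Fin.last n) (liftTerm t)).realize (Sum.elim a w) = 0 :=
  realize_termPDeriv_relabel_of_not_mem_range _
    (by rintro ⟨j, hj⟩; exact (Fin.castSucc_lt_last j).ne hj) t _

/-- Gradient of a lifted term: `(∇t(β), 0)`. [folklore] -/
theorem grad_liftTerm (t : Language.orderedExpRing.Term (κ ⊕ Fin n)) (a : κ → K) (β : Fin n → K)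
    (y : K) : grad (liftTerm t) a (Fin.snoc β y) = Fin.snoc (grad t a β) 0 := by
  funext j
  refine Fin.lastCases ?_ (fun j => ?_) j
  · simp [grad]
  · simp [grad]

/-- The system `h₁, …, hₚ, hₚ₊₁` in the variables `x₁, …, xₙ₊₁`, where
`hₚ₊₁(x̄, xₙ₊₁) = xₙ₊₁ · f(x̄) - 1` (Wilkie 1989, p. 396). [cite: Wilkie1989, proof of Lemma 3, p. 396] -/
def liftSys (h : Fin p → Language.orderedExpRing.Term (κ ⊕ Fin n))
    (fT : Language.orderedExpRing.Term (κ ⊕ Fin n)) :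
    Fin (p + 1) → Language.orderedExpRing.Term (κ ⊕ Fin (n + 1)) :=
  Fin.snoc (fun r => liftTerm (h r)) (var (Sum.inr (Fin.last n)) * liftTerm fT + -1)

/-- The zero set of the lifted system: `(β, y) ∈ V(h₁, …, hₚ₊₁)` iff `β ∈ V(h₁, …, hₚ)` and
`y · f(β) = 1`. [cite: Wilkie1989, proof of Lemma 3, p. 396] -/
theorem snoc_mem_zeroSet_liftSys {h : Fin p → Language.orderedExpRing.Term (κ ⊕ Fin n)}
    {fT : Language.orderedExpRing.Term (κ ⊕ Fin n)} {a : κ → K} {β : Fin n → K} {y : K} :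
    (Fin.snoc β y : Fin (n + 1) → K) ∈ zeroSet (liftSys h fT) a ↔
      β ∈ zeroSet h a ∧ y * fT.realize (Sum.elim a β) = 1 := by
  simp only [mem_zeroSet, liftSys]
  constructor
  · intro H
    refine ⟨fun r => by simpa using H (Fin.castSucc r), ?_⟩
    have := H (Fin.last p)
    simp at this
    rwa [add_neg_eq_zero] at this
  · rintro ⟨H1, H2⟩ r
    refine Fin.lastCases ?_ (fun r => ?_) r
    · simp [H2]
    · simpa using H1 r

/-- Gradient of `hₚ₊₁ = xₙ₊₁ · f - 1` at `(β, y)`: `(y ∇f(β), f(β))`. [folklore] -/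
theorem grad_liftSys_last (h : Fin p → Language.orderedExpRing.Term (κ ⊕ Fin n))
    (fT : Language.orderedExpRing.Term (κ ⊕ Fin n)) (a : κ → K) (β : Fin n → K) (y : K) :
    grad (liftSys h fT (Fin.last p)) a (Fin.snoc β y) =
      Fin.snoc (y • grad fT a β) (fT.realize (Sum.elim a β)) := by
  funext j
  refine Fin.lastCases ?_ (fun j => ?_) j
  · simp [grad, liftSys, termPDeriv]
  · have hne : Fin.last n ≠ j.castSucc := (Fin.castSucc_lt_last j).ne'
    simp [grad, liftSys, termPDeriv, hne]

/-- Gradient of the lifted `hᵣ` at `(β, y)`: `(∇hᵣ(β), 0)`. [folklore] -/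
theorem grad_liftSys_castSucc (h : Fin p → Language.orderedExpRing.Term (κ ⊕ Fin n))
    (fT : Language.orderedExpRing.Term (κ ⊕ Fin n)) (a : κ → K) (β : Fin n → K) (y : K)
    (r : Fin p) :
    grad (liftSys h fT (Fin.castSucc r)) a (Fin.snoc β y) = Fin.snoc (grad (h r) a β) 0 := by
  simp [liftSys, grad_liftTerm]

/-- The linear map `v ↦ (v, 0)`. [folklore] -/
def snocZero (K : Language.Theory.ModelType.{0, 0, 0} realExpTheory) (n : ℕ) :
    (Fin n → K) →ₗ[K] (Fin (n + 1) → K) where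
  toFun v := Fin.snoc v 0
  map_add' v w := by
    funext j; refine Fin.lastCases ?_ (fun j => ?_) j <;> simp
  map_smul' c v := by
    funext j; refine Fin.lastCases ?_ (fun j => ?_) j <;> simp

/-- `v ↦ (v, 0)` is injective. [folklore] -/
theorem snocZero_injective (K : Language.Theory.ModelType.{0, 0, 0} realExpTheory) (n : ℕ) :
    Function.Injective (snocZero K n) := by
  intro v w hvw
  funext j
  have := congrFun hvw (Fin.castSucc j)
  simpa [snocZero] using this

/-- **(∗) of p. 396–397**: every point of `V(h₁, …, hₚ₊₁)` above a point where the gradient rows of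
`h₁, …, hₚ` are independent is a non-singular point of the lifted system: the rows
`(∇hᵣ(β), 0)` and `(y ∇f(β), f(β))`, `f(β) ≠ 0`, are linearly independent.
[cite: Wilkie1989, proof of Lemma 3, pp. 396–397] -/
theorem linearIndependent_grad_liftSys {h : Fin p → Language.orderedExpRing.Term (κ ⊕ Fin n)}
    {fT : Language.orderedExpRing.Term (κ ⊕ Fin n)} {a : κ → K} {β : Fin n → K} {y : K}
    (hind : LinearIndependent K (fun r => grad (h r) a β)) (hf : fT.realize (Sum.elim a β) ≠ 0) :
    LinearIndependent K (fun r => grad (liftSys h fT r) a (Fin.snoc β y)) := by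
  have e : (fun r => grad (liftSys h fT r) a (Fin.snoc β y)) =
      Fin.snoc (fun r => Fin.snoc (grad (h r) a β) (0 : K))
        (Fin.snoc (y • grad fT a β) (fT.realize (Sum.elim a β))) := by
    funext r
    refine Fin.lastCases ?_ (fun r => ?_) r
    · simp [grad_liftSys_last]
    · simp [grad_liftSys_castSucc]
  rw [e, linearIndependent_finSnoc]
  constructor
  · exact (hind.map' (snocZero K n) (LinearMap.ker_eq_bot.2 (snocZero_injective K n)))
  · intro hmem
    -- every vector in the span has last coordinate `0`
    have hlast : ∀ v ∈ Submodule.span K (Set.range fun r => (Fin.snoc (grad (h r) a β) (0 : K) :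
        Fin (n + 1) → K)), v (Fin.last n) = 0 := by
      intro v hv
      refine Submodule.span_induction (p := fun v _ => v (Fin.last n) = 0) ?_ ?_ ?_ ?_ hv
      · rintro _ ⟨r, rfl⟩; simp
      · simp
      · intro v w _ _ hv hw; simp [hv, hw]
      · intro c v _ hv; simp [hv]
    have := hlast _ hmem
    simp at this
    exact hf this

end Lift

/-! ### The minor `f`, the vector `w_η` and the term expressing `(ω ∧ dD_η)(x̄) = 0` (p. 397) -/

section LagTerms

variable {K : Language.Theory.ModelType.{0, 0, 0} realExpTheory} {κ : Type} {n p : ℕ}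

/-- The coefficient of `dx_{I 1} ∧ ⋯ ∧ dx_{I p}` in `dh₁ ∧ ⋯ ∧ dhₚ`: the `p × p` minor of the
Jacobian matrix of terms `(∂hᵣ/∂xⱼ)` on the columns `I`, as a term (Wilkie 1989, p. 386 and
p. 396: "let `f(x̄)` be a coefficient of `dh₁ ∧ ⋯ ∧ dhₚ` such that `f(ᾱ) ≠ 0`"). [cite: Wilkie1989, proof of Lemma 3, p. 396] -/
def minorTerm (h : Fin p → Language.orderedExpRing.Term (κ ⊕ Fin n)) (I : Fin p → Fin n) :
    Language.orderedExpRing.Term (κ ⊕ Fin n) :=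
  ExpTerm.det (Matrix.of fun r s => termPDeriv (I s) (h r))

/-- The minor term realizes to the corresponding minor of the Jacobian (in any lawful structure,
e.g. `ℝ` or a model of `T_exp`). [folklore] -/
@[simp] theorem realize_minorTerm {M : Type*} [Language.orderedExpRing.Structure M] [Field M]
    [LinearOrder M] [LawfulStructure M] (h : Fin p → Language.orderedExpRing.Term (κ ⊕ Fin n))
    (I : Fin p → Fin n) (a : κ → M) (β : Fin n → M) :
    (minorTerm h I).realize (Sum.elim a β) =
      ((Matrix.of fun r => grad (h r) a β).submatrix _root_.id I).det := by
  rw [minorTerm, ExpTerm.realize_det]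
  rfl

/-- The `j`-th coordinate of the vector `w_η(x̄) = f(x̄)³ (x̄ - η̄) - ∇f(x̄)`, as a term; up to the
factor `f³/2` this is the gradient of Wilkie's `D_η⁻(x̄) = Σ (xᵢ - ηᵢ)² + f(x̄)⁻²` (p. 397), whose
membership in the span of `∇h₁, …, ∇hₚ` is the condition `(ω ∧ dD_η⁻)(x̄) = 0`. The point `η̄`
has coordinates the parameters named by `η`. [cite: Wilkie1989, proof of Lemma 3, p. 397] -/
def wTerm (fT : Language.orderedExpRing.Term (κ ⊕ Fin n)) (η : Fin n → κ) (j : Fin n) :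
    Language.orderedExpRing.Term (κ ⊕ Fin n) :=
  fT * fT * fT * (var (Sum.inr j) + -var (Sum.inl (η j))) + -termPDeriv j fT

/-- The vector `w_η(β) ∈ Kⁿ`. [folklore] -/
def wVec (fT : Language.orderedExpRing.Term (κ ⊕ Fin n)) (η : Fin n → κ) (a : κ → K)
    (β : Fin n → K) : Fin n → K :=
  fun j => (wTerm fT η j).realize (Sum.elim a β)

/-- Coordinates of `w_η(β)`. [folklore] -/
theorem wVec_apply (fT : Language.orderedExpRing.Term (κ ⊕ Fin n)) (η : Fin n → κ) (a : κ → K)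
    (β : Fin n → K) (j : Fin n) :
    wVec fT η a β j =
      fT.realize (Sum.elim a β) ^ 3 * (β j - a (η j)) - grad fT a β j := by
  simp [wVec, wTerm, grad]
  ring

/-- **The Lagrange condition for `D_η`** at `β` (the content of `(ω ∧ dD_η⁻)(β) = 0`, p. 397):
`w_η(β)` lies in the span of `∇h₁(β), …, ∇hₚ(β)`. [cite: Wilkie1989, proof of Lemma 3, p. 397] -/
def LagCond (h : Fin p → Language.orderedExpRing.Term (κ ⊕ Fin n))
    (fT : Language.orderedExpRing.Term (κ ⊕ Fin n)) (η : Fin n → κ) (a : κ → K)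
    (β : Fin n → K) : Prop :=
  wVec fT η a β ∈ Submodule.span K (Set.range fun r => grad (h r) a β)

/-- The `(p+1) × n` matrix of terms with rows `∇h₁, …, ∇hₚ, w_η`. [folklore] -/
def lagMatrix (h : Fin p → Language.orderedExpRing.Term (κ ⊕ Fin n))
    (fT : Language.orderedExpRing.Term (κ ⊕ Fin n)) (η : Fin n → κ) :
    Matrix (Fin (p + 1)) (Fin n) (Language.orderedExpRing.Term (κ ⊕ Fin n)) :=
  Matrix.of (Fin.snoc (fun r j => termPDeriv j (h r)) fun j => wTerm fT η j)

/-- The rows of the realized matrix. [folklore] -/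
theorem lagMatrix_map_realize (h : Fin p → Language.orderedExpRing.Term (κ ⊕ Fin n))
    (fT : Language.orderedExpRing.Term (κ ⊕ Fin n)) (η : Fin n → κ) (a : κ → K) (β : Fin n → K) :
    (lagMatrix h fT η).map (fun t => t.realize (Sum.elim a β)) =
      Matrix.of (Fin.snoc (fun r => grad (h r) a β) (wVec fT η a β)) := by
  ext r j
  refine Fin.lastCases ?_ (fun r => ?_) r
  · simp [lagMatrix, wVec]
  · simp [lagMatrix, grad]

/-- **The term `L_η`**: the sum of the squares of all `(p+1) × (p+1)` minors of the matrix with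
rows `∇h₁, …, ∇hₚ, w_η` ("the sum of the squares of the coefficients of `ω ∧ dD_η⁻`", up to the
power of `f` clearing denominators; Wilkie 1989, p. 397). [cite: Wilkie1989, proof of Lemma 3, p. 397] -/
def lagTerm (h : Fin p → Language.orderedExpRing.Term (κ ⊕ Fin n))
    (fT : Language.orderedExpRing.Term (κ ⊕ Fin n)) (η : Fin n → κ) :
    Language.orderedExpRing.Term (κ ⊕ Fin n) :=
  ExpTerm.sum fun l : Fin (Fintype.card (Fin (p + 1) → Fin n)) =>
    ExpTerm.det ((lagMatrix h fT η).submatrix _root_.id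
        ((Fintype.equivFin (Fin (p + 1) → Fin n)).symm l)) *
      ExpTerm.det ((lagMatrix h fT η).submatrix _root_.id
        ((Fintype.equivFin (Fin (p + 1) → Fin n)).symm l))

/-- `L_η(β) = 0` iff the rows `∇h₁(β), …, ∇hₚ(β), w_η(β)` are linearly dependent. [folklore] -/
theorem realize_lagTerm_eq_zero_iff (h : Fin p → Language.orderedExpRing.Term (κ ⊕ Fin n))
    (fT : Language.orderedExpRing.Term (κ ⊕ Fin n)) (η : Fin n → κ) (a : κ → K) (β : Fin n → K) :
    (lagTerm h fT η).realize (Sum.elim a β) = 0 ↔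
      ¬ LinearIndependent K (Fin.snoc (fun r => grad (h r) a β) (wVec fT η a β) :
        Fin (p + 1) → Fin n → K) := by
  set e := Fintype.equivFin (Fin (p + 1) → Fin n) with he
  set A : Matrix (Fin (p + 1)) (Fin n) K :=
    Matrix.of (Fin.snoc (fun r => grad (h r) a β) (wVec fT η a β)) with hA
  have hdet : ∀ I : Fin (p + 1) → Fin n,
      (ExpTerm.det ((lagMatrix h fT η).submatrix _root_.id I)).realize (Sum.elim a β) =
        (A.submatrix _root_.id I).det := by
    intro I
    rw [ExpTerm.realize_det, hA, ← lagMatrix_map_realize]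
    rfl
  have hsum : (lagTerm h fT η).realize (Sum.elim a β) =
      ∑ l, (A.submatrix _root_.id (e.symm l)).det * (A.submatrix _root_.id (e.symm l)).det := by
    rw [lagTerm, ExpTerm.realize_sum]
    refine Finset.sum_congr rfl fun l _ => ?_
    rw [ExpTerm.realize_mul, hdet]
  rw [hsum, Finset.sum_eq_zero_iff_of_nonneg (fun l _ => mul_self_nonneg _)]
  have hrows : (fun i => A i) = (Fin.snoc (fun r => grad (h r) a β) (wVec fT η a β) :
      Fin (p + 1) → Fin n → K) := rfl
  rw [← hrows, linearIndependent_rows_iff_exists_det_submatrix_ne_zero, not_exists]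
  constructor
  · intro H I
    have := H (e I) (Finset.mem_univ _)
    rw [Equiv.symm_apply_apply] at this
    simpa using this
  · intro H l _
    have := not_not.1 (H (e.symm l))
    simp [this]

/-- If `∇h₁(β), …, ∇hₚ(β)` are independent, then `L_η(β) = 0` iff the Lagrange condition for
`D_η` holds at `β`. [folklore] -/
theorem realize_lagTerm_eq_zero_iff_lagCond {h : Fin p → Language.orderedExpRing.Term (κ ⊕ Fin n)}
    {fT : Language.orderedExpRing.Term (κ ⊕ Fin n)} (η : Fin n → κ) {a : κ → K} {β : Fin n → K}
    (hind : LinearIndependent K (fun r => grad (h r) a β)) :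
    (lagTerm h fT η).realize (Sum.elim a β) = 0 ↔ LagCond h fT η a β := by
  rw [realize_lagTerm_eq_zero_iff, linearIndependent_finSnoc, LagCond]
  tauto

end LagTerms

/-! ### The core step of the proof of Lemma 3 (p. 397) -/

section Core

variable {K : Language.Theory.ModelType.{0, 0, 0} realExpTheory} {κ : Type} {n p : ℕ}
  {a : κ → K} {h : Fin p → Language.orderedExpRing.Term (κ ⊕ Fin n)}
  {F fT : Language.orderedExpRing.Term (κ ⊕ Fin n)}

/-- **The core step** (Wilkie 1989, p. 397).  Data: `h₁, …, hₚ, F, f ∈ k[x̄]ᵉ` such that (i) at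
every point of `V(h₁, …, hₚ)` where `f ≠ 0` the rows `∇hᵣ` are independent (for Wilkie's `f`, a
coefficient of `dh₁ ∧ ⋯ ∧ dhₚ`, this is automatic), and (ii) clause (3) of Lemma 1 for
`S = V(F)`: every `g ∈ k[x̄]ᵉ` vanishing at a point `β ∈ V(F) ∩ Vⁿˢ(h₁, …, hₚ)` vanishes on
`V(h₁, …, hₚ)` close to `β`.  Then for every `G ∈ k[x̄]ᵉ` with `V(G) ⊆ V(F)` having a zero on
`V(h₁, …, hₚ) ∩ {f ≠ 0}` and every `η̄`, there is `γ ∈ V(h₁, …, hₚ) ∩ V(G)` with `f(γ) ≠ 0` at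
which the Lagrange condition for `D_η` holds: take a point `(γ, γₙ₊₁)` of
`V(h₁, …, hₚ₊₁, G)` at minimal distance from `(η̄, 0)` (by transfer), observe that it is a local
minimum of the distance on `V(h₁, …, hₚ₊₁)` because `G` vanishes on `V(h₁, …, hₚ)` close to `γ`,
and apply Lagrange multipliers (by transfer, "by Section 2") at this non-singular point
(by (∗)). [cite: Wilkie1989, proof of Lemma 3, p. 397] -/
theorem exists_lagCond
    (hfT : ∀ β ∈ zeroSet h a, fT.realize (Sum.elim a β) ≠ 0 →
      LinearIndependent K (fun r => grad (h r) a β))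
    (h3 : ∀ β, F.realize (Sum.elim a β) = 0 → β ∈ nonsingularZeroSet h a →
      ∀ g : Language.orderedExpRing.Term (κ ⊕ Fin n), g.realize (Sum.elim a β) = 0 →
        VanishesCloseTo g h a β)
    (G : Language.orderedExpRing.Term (κ ⊕ Fin n))
    (hGF : ∀ β, G.realize (Sum.elim a β) = 0 → F.realize (Sum.elim a β) = 0)
    (hne : ∃ β₀ ∈ zeroSet h a, G.realize (Sum.elim a β₀) = 0 ∧ fT.realize (Sum.elim a β₀) ≠ 0)
    (η : Fin n → κ) :
    ∃ γ ∈ zeroSet h a, fT.realize (Sum.elim a γ) ≠ 0 ∧ G.realize (Sum.elim a γ) = 0 ∧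
      LagCond h fT η a γ := by
  classical
  obtain ⟨β₀, hβ₀V, hGβ₀, hfβ₀⟩ := hne
  -- the system `h₁, …, hₚ₊₁, G` in the variables `x₁, …, xₙ₊₁` and the centre `(η̄, 0)`
  let sys : Fin (p + 1 + 1) → Language.orderedExpRing.Term (κ ⊕ Fin (n + 1)) :=
    Fin.snoc (liftSys h fT) (liftTerm G)
  let c : Fin (n + 1) → Language.orderedExpRing.Term κ := Fin.snoc (fun j => var (η j)) 0
  have hsysmem : ∀ (β : Fin n → K) (y : K), (Fin.snoc β y : Fin (n + 1) → K) ∈ zeroSet sys a ↔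
      (β ∈ zeroSet h a ∧ y * fT.realize (Sum.elim a β) = 1) ∧ G.realize (Sum.elim a β) = 0 := by
    intro β y
    rw [← snoc_mem_zeroSet_liftSys (h := h) (fT := fT) (a := a)]
    simp only [mem_zeroSet]
    constructor
    · intro H
      refine ⟨fun r => by simpa [sys] using H (Fin.castSucc r), ?_⟩
      simpa [sys] using H (Fin.last _)
    · rintro ⟨H1, H2⟩ r
      refine Fin.lastCases ?_ (fun r => ?_) r
      · simpa [sys] using H2
      · simpa [sys] using H1 r
  have hne' : ∃ x : Fin (n + 1) → K, ∀ r, (sys r).realize (Sum.elim a x) = 0 :=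
    ⟨Fin.snoc β₀ (fT.realize (Sum.elim a β₀))⁻¹,
      (hsysmem _ _).2 ⟨⟨hβ₀V, inv_mul_cancel₀ hfβ₀⟩, hGβ₀⟩⟩
  obtain ⟨v, hvV, hvmin⟩ := exists_isMinOn_sqDist K a sys c hne'
  -- write `v = (γ, y)`
  set γ : Fin n → K := Fin.init v with hγdef
  set y : K := v (Fin.last n) with hydef
  have hv : v = Fin.snoc γ y := (Fin.snoc_init_self v).symm
  rw [hv] at hvV hvmin
  obtain ⟨⟨hγV, hy⟩, hGγ⟩ := (hsysmem γ y).1 hvV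
  have hfγ : fT.realize (Sum.elim a γ) ≠ 0 := by
    intro h0; rw [h0, mul_zero] at hy; exact zero_ne_one hy
  have hind : LinearIndependent K (fun r => grad (h r) a γ) := hfT γ hγV hfγ
  refine ⟨γ, hγV, hfγ, hGγ, ?_⟩
  -- `G` vanishes on `V(h)` close to `γ`
  obtain ⟨δ, hδ, hGloc⟩ := h3 γ (hGF γ hGγ) ⟨hγV, hind⟩ G hGγ
  -- hence `(γ, y)` is a local minimum of the distance to `(η̄, 0)` on `V(h₁, …, hₚ₊₁)`
  have hlocmin : ∀ x : Fin (n + 1) → K,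
      ∑ j, (x j - (Fin.snoc γ y : Fin (n + 1) → K) j) ^ 2 < δ →
        (∀ r, (liftSys h fT r).realize (Sum.elim a x) = 0) →
          (sqDist c).realize (Sum.elim a (Fin.snoc γ y : Fin (n + 1) → K)) ≤
            (sqDist c).realize (Sum.elim a x) := by
    intro x hx hxV
    have hx' : x = Fin.snoc (Fin.init x) (x (Fin.last n)) := (Fin.snoc_init_self x).symm
    rw [hx'] at hx hxV ⊢
    obtain ⟨hαV, hz⟩ := (snoc_mem_zeroSet_liftSys (h := h) (fT := fT) (a := a)).1 hxV
    have hdist : ∑ j, (Fin.init x j - γ j) ^ 2 < δ := by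
      refine lt_of_le_of_lt ?_ hx
      rw [Fin.sum_univ_castSucc]
      simp only [Fin.snoc_castSucc, Fin.snoc_last]
      exact le_add_of_nonneg_right (sq_nonneg _)
    have hGα : G.realize (Sum.elim a (Fin.init x)) = 0 := hGloc _ hdist hαV
    have hmemsys : (Fin.snoc (Fin.init x) (x (Fin.last n)) : Fin (n + 1) → K) ∈ zeroSet sys a :=
      (hsysmem _ _).2 ⟨⟨hαV, hz⟩, hGα⟩
    have := hvmin _ hmemsys
    rw [realize_sqDist, realize_sqDist]
    exact this
  have hdep := not_linearIndependent_gradRows_of_isLocalMin K a (liftSys h fT) (sqDist c)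
    (Fin.snoc γ y) (snoc_mem_zeroSet_liftSys.2 ⟨hγV, hy⟩) hδ hlocmin
  rw [linearIndependent_option] at hdep
  have hLI : LinearIndependent K
      ((gradRows (liftSys h fT) (sqDist c) a (Fin.snoc γ y)) ∘ (↑) : Fin (p + 1) → Fin (n + 1) → K) :=
    linearIndependent_grad_liftSys hind hfγ
  have hmem : grad (sqDist c) a (Fin.snoc γ y) ∈
      Submodule.span K (Set.range fun r => grad (liftSys h fT r) a (Fin.snoc γ y)) := by
    by_contra hnot
    exact hdep ⟨hLI, hnot⟩
  rw [Submodule.mem_span_range_iff_exists_fun] at hmem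
  obtain ⟨μ, hμ⟩ := hmem
  -- read off the coordinates of `Σ μᵣ ∇hᵣ⁺ = ∇D_η`
  have hgradD : grad (sqDist c) a (Fin.snoc γ y) =
      fun j => 2 * ((Fin.snoc γ y : Fin (n + 1) → K) j - (c j).realize a) :=
    funext fun j => realize_termPDeriv_sqDist c a _ j
  rw [Fin.sum_univ_castSucc, hgradD] at hμ
  simp only [grad_liftSys_castSucc, grad_liftSys_last] at hμ
  have hlast : μ (Fin.last p) * fT.realize (Sum.elim a γ) = 2 * y := by
    have := congrFun hμ (Fin.last n)
    simpa [Finset.sum_apply, Pi.smul_apply, c] using this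
  have hcoord : ∀ j : Fin n,
      (∑ r : Fin p, μ (Fin.castSucc r) * grad (h r) a γ j) +
          μ (Fin.last p) * (y * grad fT a γ j) = 2 * (γ j - a (η j)) := by
    intro j
    have := congrFun hμ (Fin.castSucc j)
    simpa [Finset.sum_apply, Pi.smul_apply, c] using this
  -- the Lagrange condition: `w_η(γ) = Σ (μᵣ f³ / 2) ∇hᵣ(γ)`
  rw [LagCond, Submodule.mem_span_range_iff_exists_fun]
  refine ⟨fun r => μ (Fin.castSucc r) * fT.realize (Sum.elim a γ) ^ 3 / 2, ?_⟩
  funext j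
  rw [wVec_apply]
  simp only [Finset.sum_apply, Pi.smul_apply, smul_eq_mul]
  have e1 : (∑ r : Fin p, μ (Fin.castSucc r) * fT.realize (Sum.elim a γ) ^ 3 / 2 * grad (h r) a γ j)
      = fT.realize (Sum.elim a γ) ^ 3 / 2 * ∑ r : Fin p, μ (Fin.castSucc r) * grad (h r) a γ j := by
    rw [Finset.mul_sum]
    refine Finset.sum_congr rfl fun r _ => ?_
    ring
  rw [e1]
  set f := fT.realize (Sum.elim a γ) with hf
  set S := ∑ r : Fin p, μ (Fin.castSucc r) * grad (h r) a γ j with hS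
  set d := grad fT a γ j with hd
  have hc := hcoord j
  rw [← hS] at hc
  linear_combination (f ^ 3 / 2) * hc + (-(d * f ^ 2 * y / 2)) * hlast +
    (-(d * (y * f + 1))) * hy

end Core

/-! ### The iteration over `η̄ = 0̄, e₁, …, eₙ` and the contradiction (pp. 397–398) -/

section Iteration

variable {K : Language.Theory.ModelType.{0, 0, 0} realExpTheory} {κ : Type} {n p : ℕ}

/-- The points `η̄⁽⁰⁾ = 0̄` and `η̄⁽ⁱ⁾ = (0, …, 0, 1, 0, …, 0)` (`1` in the `i`-th place), given
by names `z, o` of parameters with values `0, 1` (Wilkie 1989, p. 398). [cite: Wilkie1989, proof of Lemma 3, p. 398] -/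
def etaSeq (z o : κ) : Fin (n + 1) → Fin n → κ :=
  Fin.cons (fun _ => z) fun i j => if j = i then o else z

/-- `G_{m+1} = G_m² + L_m²`, where `L_m = L_{η⁽ᵐ⁾}`: a single term whose zero set is
`V(G_m) ∩ V(L_m)` (Wilkie's `G = F² + f⁶ · (sum of squares of the coefficients of
`ω ∧ dD_η⁻`)`, p. 397). [cite: Wilkie1989, proof of Lemma 3, p. 397] -/
def iterTerm (h : Fin p → Language.orderedExpRing.Term (κ ⊕ Fin n))
    (F fT : Language.orderedExpRing.Term (κ ⊕ Fin n)) (z o : κ) : ℕ → Language.orderedExpRing.Term (κ ⊕ Fin n)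
  | 0 => F
  | m + 1 =>
    if hm : m < n + 1 then
      iterTerm h F fT z o m * iterTerm h F fT z o m +
        lagTerm h fT (etaSeq z o ⟨m, hm⟩) * lagTerm h fT (etaSeq z o ⟨m, hm⟩)
    else iterTerm h F fT z o m

variable {a : κ → K} {h : Fin p → Language.orderedExpRing.Term (κ ⊕ Fin n)}
  {F fT : Language.orderedExpRing.Term (κ ⊕ Fin n)} {z o : κ}

/-- In an ordered field, `u² + w² = 0` iff `u = 0` and `w = 0`. [folklore] -/
theorem mul_self_add_mul_self_eq_zero_iff (u w : K) : u * u + w * w = 0 ↔ u = 0 ∧ w = 0 := by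
  rw [add_eq_zero_iff_of_nonneg (mul_self_nonneg u) (mul_self_nonneg w), mul_self_eq_zero,
    mul_self_eq_zero]

/-- `V(G_{m+1}) ⊆ V(G_m)`. [folklore] -/
theorem realize_iterTerm_succ_eq_zero {m : ℕ} {β : Fin n → K}
    (hβ : (iterTerm h F fT z o (m + 1)).realize (Sum.elim a β) = 0) :
    (iterTerm h F fT z o m).realize (Sum.elim a β) = 0 ∧
      ∀ hm : m < n + 1, (lagTerm h fT (etaSeq z o ⟨m, hm⟩)).realize (Sum.elim a β) = 0 := by
  rw [iterTerm] at hβ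
  split_ifs at hβ with hm
  · rw [ExpTerm.realize_add, ExpTerm.realize_mul, ExpTerm.realize_mul,
      mul_self_add_mul_self_eq_zero_iff] at hβ
    exact ⟨hβ.1, fun _ => hβ.2⟩
  · exact ⟨hβ, fun hm' => (hm hm').elim⟩

/-- `V(G_m) ⊆ V(F)`. [folklore] -/
theorem realize_F_eq_zero_of_iterTerm {m : ℕ} {β : Fin n → K}
    (hβ : (iterTerm h F fT z o m).realize (Sum.elim a β) = 0) : F.realize (Sum.elim a β) = 0 := by
  induction m with
  | zero => simpa [iterTerm] using hβ
  | succ m ih => exact ih (realize_iterTerm_succ_eq_zero hβ).1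

/-- `V(G_m) ⊆ V(L_{η⁽ⁱ⁾})` for `i < m`. [folklore] -/
theorem realize_lagTerm_eq_zero_of_iterTerm {m : ℕ} {β : Fin n → K}
    (hβ : (iterTerm h F fT z o m).realize (Sum.elim a β) = 0) (i : Fin (n + 1)) (hi : (i : ℕ) < m) :
    (lagTerm h fT (etaSeq z o i)).realize (Sum.elim a β) = 0 := by
  induction m with
  | zero => exact (Nat.not_lt_zero _ hi).elim
  | succ m ih =>
    obtain ⟨h1, h2⟩ := realize_iterTerm_succ_eq_zero hβ
    rcases Nat.lt_succ_iff_lt_or_eq.1 hi with hlt | heq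
    · exact ih h1 hlt
    · have hm : m < n + 1 := heq ▸ i.isLt
      have : (⟨m, hm⟩ : Fin (n + 1)) = i := Fin.ext heq.symm
      rw [← this]
      exact h2 hm

/-- **The iteration** (Wilkie 1989, pp. 397–398: "Continuing, we see that for any `r ∈ ℕ` and
`η̄⁽⁰⁾, …, η̄⁽ʳ⁾ ∈ kⁿ`, there is `γ ∈ Vⁿˢ(h₁, …, hₚ) ∩ V(F)` such that `(ω ∧ dD_{η⁽ʲ⁾}⁻)(γ) = 0`
for `j = 0, …, r`"), for `η̄ = 0̄, e₁, …, eₙ`. [cite: Wilkie1989, proof of Lemma 3, pp. 397–398] -/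
theorem exists_point_allLag
    (hfT : ∀ β ∈ zeroSet h a, fT.realize (Sum.elim a β) ≠ 0 →
      LinearIndependent K (fun r => grad (h r) a β))
    (h3 : ∀ β, F.realize (Sum.elim a β) = 0 → β ∈ nonsingularZeroSet h a →
      ∀ g : Language.orderedExpRing.Term (κ ⊕ Fin n), g.realize (Sum.elim a β) = 0 →
        VanishesCloseTo g h a β)
    {α : Fin n → K} (hαV : α ∈ zeroSet h a) (hFα : F.realize (Sum.elim a α) = 0)
    (hfα : fT.realize (Sum.elim a α) ≠ 0) :
    ∃ β ∈ zeroSet h a, fT.realize (Sum.elim a β) ≠ 0 ∧ ∀ i : Fin (n + 1), LagCond h fT (etaSeq z o i) a β := by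
  -- points `β_m ∈ V(h) ∩ V(G_m)` with `f(β_m) ≠ 0`, by induction on `m ≤ n + 1`
  have key : ∀ m, m ≤ n + 1 → ∃ β ∈ zeroSet h a, fT.realize (Sum.elim a β) ≠ 0 ∧
      (iterTerm h F fT z o m).realize (Sum.elim a β) = 0 := by
    intro m
    induction m with
    | zero => exact fun _ => ⟨α, hαV, hfα, by simpa [iterTerm] using hFα⟩
    | succ m ih =>
      intro hm
      have hm' : m < n + 1 := Nat.lt_of_succ_le hm
      obtain ⟨βm, hβmV, hfβm, hGβm⟩ := ih hm'.le
      obtain ⟨γ, hγV, hfγ, hGγ, hlag⟩ := exists_lagCond hfT h3 (iterTerm h F fT z o m)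
        (fun β hβ => realize_F_eq_zero_of_iterTerm hβ) ⟨βm, hβmV, hGβm, hfβm⟩ (etaSeq z o ⟨m, hm'⟩)
      refine ⟨γ, hγV, hfγ, ?_⟩
      have hL : (lagTerm h fT (etaSeq z o ⟨m, hm'⟩)).realize (Sum.elim a γ) = 0 :=
        (realize_lagTerm_eq_zero_iff_lagCond _ (hfT γ hγV hfγ)).2 hlag
      rw [iterTerm, dif_pos hm', ExpTerm.realize_add, ExpTerm.realize_mul, ExpTerm.realize_mul,
        hGγ, hL]
      ring
  obtain ⟨β, hβV, hfβ, hGβ⟩ := key (n + 1) le_rfl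
  refine ⟨β, hβV, hfβ, fun i => ?_⟩
  exact (realize_lagTerm_eq_zero_iff_lagCond _ (hfT β hβV hfβ)).1
    (realize_lagTerm_eq_zero_of_iterTerm hGβ i i.isLt)

/-- **The contradiction** (Wilkie 1989, p. 398): if the Lagrange conditions for `D_0̄` and all
`D_{eᵢ}` hold at a point `β` with `f(β) ≠ 0`, then every coordinate vector lies in the span of
`∇h₁(β), …, ∇hₚ(β)` ("these equations imply `(ω ∧ dxᵢ)(γ) = 0` for `i = 1, …, n`"), so `n ≤ p`
(the fact `(∗∗)` of p. 395 for a nonzero `p`-form with `p < n`). [cite: Wilkie1989, proof of Lemma 3, p. 398] -/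
theorem le_of_allLag (hz : a z = 0) (ho : a o = 1) {β : Fin n → K}
    (hfβ : fT.realize (Sum.elim a β) ≠ 0) (hlag : ∀ i : Fin (n + 1), LagCond h fT (etaSeq z o i) a β) :
    n ≤ p := by
  classical
  refine card_le_of_forall_single_mem_span (v := fun r => grad (h r) a β) fun i => ?_
  have h0 := hlag 0
  have hi := hlag i.succ
  simp only [LagCond] at h0 hi
  have hdiff := Submodule.sub_mem _ h0 hi
  have e : wVec fT (etaSeq z o 0) a β - wVec fT (etaSeq z o i.succ) a β =
      (fT.realize (Sum.elim a β) ^ 3) • (Pi.single i 1 : Fin n → K) := by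
    funext j
    simp only [Pi.sub_apply, wVec_apply, etaSeq, Fin.cons_zero, Fin.cons_succ, Pi.smul_apply,
      smul_eq_mul]
    by_cases hji : j = i
    · subst hji; simp [hz, ho]; ring
    · simp [hji, hz]
  rw [e] at hdiff
  exact (Submodule.smul_mem_iff _ (pow_ne_zero 3 hfβ)).1 hdiff

end Iteration

/-! ### Lemma 1 (named fact) and Lemma 3 (proved from it) -/

/-- **Wilkie 1989, Lemma 1** (p. 391), clauses (2) and (3), under the standing assumption "Let us
suppose that `k` is countable" (p. 391).  "Suppose `n ∈ ℕ`, `n ≥ 1`, and let `S` be any non-empty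
subset of `Kⁿ`. Then for some `p ∈ ℕ`, `0 ≤ p ≤ n`, there are `h₁, …, hₚ ∈ k[x̄]ᵉ` such that: …
(2) For some `ᾱ ∈ S`, `h₁(ᾱ) = ⋯ = hₚ(ᾱ) = 0` and `(dh₁ ∧ ⋯ ∧ dhₚ)(ᾱ) ≠ 0`.
(3) Either `p = n` or for any `β ∈ S` and `h ∈ k[x̄]ᵉ`, if `h₁(β) = ⋯ = hₚ(β) = 0` and
`h(β) = 0` and `(dh₁ ∧ ⋯ ∧ dhₚ)(β) ≠ 0`, then `h` vanishes on `V(h₁, …, hₚ)` close to `β`."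
Here `K ⊨ T_exp`, `k ⊆ K` is a countable submodel (Wilkie: a countable subfield), terms with
parameters from `k` stand for `k[x̄]ᵉ`, and `(dh₁ ∧ ⋯ ∧ dhₚ)(ᾱ) ≠ 0` is membership in
`RealExpModel.nonsingularZeroSet`.  Clause (1) (`rank(h₁) < ⋯ < rank(hₚ)` for the tower
`M₀ ⊆ M₁ ⊆ ⋯` of p. 391) is internal to Wilkie's inductive proof and omitted. [cite: Wilkie1989, Lemma 1] -/
def _root_.Literature.ModelTheory.ExponentialFields.Wilkie1989_lemma1 : Prop :=
  ∀ (k K : Language.Theory.ModelType.{0, 0, 0} realExpTheory) (f : k ↪[Language.orderedExpRing] K),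
    Countable k → ∀ (n : ℕ), 1 ≤ n → ∀ S : Set (Fin n → K), S.Nonempty →
      ∃ (p : ℕ) (h : Fin p → Language.orderedExpRing.Term (k ⊕ Fin n)), p ≤ n ∧
        (∃ α ∈ S, α ∈ RealExpModel.nonsingularZeroSet h f) ∧
        (p = n ∨ ∀ β ∈ S, β ∈ RealExpModel.nonsingularZeroSet h f →
          ∀ g : Language.orderedExpRing.Term (k ⊕ Fin n), g.realize (Sum.elim f β) = 0 →
            RealExpModel.VanishesCloseTo g h f β)

/-- **Lemma 3 for countable `k`, from Lemma 1** (Wilkie 1989, pp. 396–398, the printed proof).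
[cite: Wilkie1989, Lemma 3 (proof, pp. 396–398)] -/
theorem lemma3_of_lemma1_countable (H1 : Wilkie1989_lemma1)
    (k K : Language.Theory.ModelType.{0, 0, 0} realExpTheory) (f : k ↪[Language.orderedExpRing] K)
    [Countable k] (n : ℕ) (F : Language.orderedExpRing.Term (k ⊕ Fin n))
    (hex : ∃ α : Fin n → K, F.realize (Sum.elim f α) = 0) :
    ∃ α : Fin n → K, F.realize (Sum.elim f α) = 0 ∧ IsExpAlgebraicPointOver f α := by
  classical
  rcases Nat.eq_zero_or_pos n with rfl | hn
  · -- `n = 0`: the empty tuple is an e.a. point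
    obtain ⟨α, hα⟩ := hex
    refine ⟨α, hα, ⟨Fin.elim0, fun i => i.elim0, ?_⟩⟩
    simp [Matrix.det_isEmpty]
  -- `n ≥ 1`: Lemma 1 for `S = V(F)`
  obtain ⟨p, h, hpn, ⟨α, hαS, hαns⟩, h3⟩ :=
    H1 k K f inferInstance n hn {α | F.realize (Sum.elim f α) = 0} hex
  by_cases hp : p = n
  · subst hp
    exact ⟨α, hαS, isExpAlgebraicPointOver_of_mem_nonsingularZeroSet f hαns⟩
  · exfalso
    have hlt : p < n := lt_of_le_of_ne hpn hp
    have h3' := h3.resolve_left hp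
    -- a nonzero coefficient `f` of `dh₁ ∧ ⋯ ∧ dhₚ` at `α`
    obtain ⟨I, -, hI⟩ := exists_det_submatrix_ne_zero_of_linearIndependent_rows
      (Matrix.of fun r => grad (h r) f α) hαns.2
    let fT := minorTerm h I
    have hfT : ∀ β ∈ zeroSet h f, fT.realize (Sum.elim f β) ≠ 0 →
        LinearIndependent K (fun r => grad (h r) f β) := by
      intro β _ hβ
      rw [realize_minorTerm] at hβ
      exact linearIndependent_rows_of_det_submatrix_ne_zero (Matrix.of fun r => grad (h r) f β) I hβ
    have hfα : fT.realize (Sum.elim f α) ≠ 0 := by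
      rw [realize_minorTerm]; exact hI
    have h3'' : ∀ β, F.realize (Sum.elim f β) = 0 → β ∈ nonsingularZeroSet h f →
        ∀ g : Language.orderedExpRing.Term (k ⊕ Fin n), g.realize (Sum.elim f β) = 0 →
          VanishesCloseTo g h f β :=
      fun β hβ hns g hg => h3' β hβ hns g hg
    obtain ⟨β, hβV, hfβ, hlag⟩ := exists_point_allLag (z := (0 : k)) (o := (1 : k)) hfT h3''
      hαns.1 hαS hfα
    have hle : n ≤ p := le_of_allLag (map_zero f) (map_one f) hfβ hlag
    exact absurd hle (not_le.2 hlt)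

/-! ### "We may clearly suppose `k` countable" (p. 396): downward Löwenheim–Skolem -/

section Countable

variable {K : Language.Theory.ModelType.{0, 0, 0} realExpTheory} {κ κ' : Type} {n : ℕ}

/-- Renaming parameters commutes with formal partial derivatives (semantically). [folklore] -/
theorem realize_termPDeriv_relabel_params (g : κ → κ') (j : Fin n)
    (t : Language.orderedExpRing.Term (κ ⊕ Fin n)) (v : κ' ⊕ Fin n → K) :
    (termPDeriv j (t.relabel (Sum.map g _root_.id))).realize v =
      (termPDeriv j t).realize (v ∘ Sum.map g _root_.id) := by
  induction t with
  | var x =>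
    rcases x with c | i
    · simp [Term.relabel, termPDeriv]
    · by_cases hij : i = j
      · subst hij; simp [Term.relabel, termPDeriv]
      · simp [Term.relabel, termPDeriv, hij]
  | func g ts ih =>
    cases g with
    | add => simp [Term.relabel, termPDeriv, ih]
    | mul => simp [Term.relabel, termPDeriv, ih, Term.realize_relabel]
    | neg => simp [Term.relabel, termPDeriv, ih]
    | zero => simp [Term.relabel, termPDeriv]
    | one => simp [Term.relabel, termPDeriv]
    | exp =>
      simp [Term.relabel, termPDeriv, ih, Term.realize_relabel, ExpTerm.realize_termExp_eq_funMap]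

/-- The language of ordered exponential rings is countable. [folklore] -/
theorem card_orderedExpRing_le_aleph0 : Language.orderedExpRing.card ≤ Cardinal.aleph0 := by
  rw [Language.card]
  exact Cardinal.mk_le_aleph0

/-- An e.a. point over an elementary submodel `k₀ ≼ k` is an e.a. point over `k`. [folklore] -/
theorem IsExpAlgebraicPointOver.of_elementarySubstructure
    {k : Language.Theory.ModelType.{0, 0, 0} realExpTheory} (f : k ↪[Language.orderedExpRing] K)
    (S : Language.orderedExpRing.ElementarySubstructure k) {α : Fin n → K}
    (hα : IsExpAlgebraicPointOver
      (k := Language.Theory.ModelType.of realExpTheory S)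
      (f.comp S.subtype.toEmbedding) α) :
    IsExpAlgebraicPointOver f α := by
  obtain ⟨G, hG0, hGdet⟩ := hα
  have e : ((Sum.elim (f : k → K) α) ∘ Sum.map (Subtype.val : S → k) _root_.id) =
      (Sum.elim ((f.comp S.subtype.toEmbedding : _ → K)) α : (S ⊕ Fin n) → K) := by
    funext x; rcases x with c | j <;> rfl
  refine ⟨fun i => (G i).relabel (Sum.map (Subtype.val : S → k) _root_.id), ?_, ?_⟩
  · intro i
    rw [Term.realize_relabel, e]
    exact hG0 i
  · have e2 : jacobian (fun i => (G i).relabel (Sum.map (Subtype.val : S → k) _root_.id)) f α =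
        jacobian G (f.comp S.subtype.toEmbedding) α := by
      ext i j
      rw [jacobian_apply, jacobian_apply, realize_termPDeriv_relabel_params, e]
      rfl
    rw [e2]
    exact hGdet

end Countable

/-- **Wilkie 1989, Lemma 3, from Lemma 1 (proved).**  "Suppose `F ∈ k[x̄]ᵉ` and `V(F) ≠ ∅`. Then
`V(F)` contains an e.a. point of `Kⁿ` over `k`."  Proof as printed (pp. 396–398): "We may clearly
suppose `k` countable" — here: replace `k` by a countable elementary submodel containing the
parameters of `F` (downward Löwenheim–Skolem), an e.a. point over which is e.a. over `k` — and
then `lemma3_of_lemma1_countable`. [cite: Wilkie1989, Lemma 3 (proof, pp. 396–398)] -/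
theorem _root_.Literature.ModelTheory.ExponentialFields.Wilkie1989_lemma3_of_lemma1 (H1 : Wilkie1989_lemma1) : Wilkie1989_lemma3 := by
  classical
  intro k K f n F hex
  -- a countable elementary substructure of `k` containing the parameters of `F`
  let s : Set k := ↑F.varFinsetLeft
  have hs : s.Finite := F.varFinsetLeft.finite_toSet
  obtain ⟨S, hsS, hcard⟩ := FirstOrder.Language.exists_elementarySubstructure_card_eq
    Language.orderedExpRing s Cardinal.aleph0.{0} le_rfl
    (by simp)
    (by simpa using card_orderedExpRing_le_aleph0)
    (by simp)
  have hS : Countable S := by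
    rw [← Cardinal.mk_le_aleph0_iff]
    have : Cardinal.mk S = Cardinal.aleph0 := by simpa using hcard
    exact this.le
  let k₀ : Language.Theory.ModelType.{0, 0, 0} realExpTheory :=
    Language.Theory.ModelType.of realExpTheory S
  haveI : Countable k₀ := hS
  let f₀ : k₀ ↪[Language.orderedExpRing] K := f.comp S.subtype.toEmbedding
  -- `F` as a term with parameters from `S`
  let F₀ : Language.orderedExpRing.Term (k₀ ⊕ Fin n) :=
    F.restrictVarLeft (Set.inclusion hsS)
  have hF₀ : ∀ α : Fin n → K, F₀.realize (Sum.elim f₀ α) = F.realize (Sum.elim f α) := by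
    intro α
    have := Term.realize_restrictVarLeft' (t := F) hsS (v := (f : k → K)) (xs := α)
    exact this
  obtain ⟨α, hα⟩ := hex
  obtain ⟨β, hβ0, hβea⟩ := lemma3_of_lemma1_countable H1 k₀ K f₀ n F₀ ⟨α, by rw [hF₀]; exact hα⟩
  exact ⟨β, by rw [← hF₀]; exact hβ0, IsExpAlgebraicPointOver.of_elementarySubstructure f S hβea⟩

/-- The refined DAG: Theorem 2 of Wilkie 1989 from Lemma 1 and the statement of §5 (proved glue:
`Wilkie1989_thm2_of_lemma3_of_mem` and `Wilkie1989_lemma3_of_lemma1`). [cite: Wilkie1989, §5, p. 399] -/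
theorem _root_.Literature.ModelTheory.ExponentialFields.Wilkie1989_thm2_of_lemma1_of_mem (H1 : Wilkie1989_lemma1)
    (hm : Wilkie1989_expAlgebraicPoints_mem) : Wilkie1989_existentiallyClosed_of_bounded :=
  Wilkie1989_thm2_of_lemma3_of_mem (Wilkie1989_lemma3_of_lemma1 H1) hm

end RealExpModel

open Filter Topology


/-! ### Real analysis: a coordinate-free consequence of the implicit function theorem -/

namespace Real

variable {E : Type*} [NormedAddCommGroup E] [NormedSpace ℝ E] [CompleteSpace E] {p : ℕ}

/-- **Functions whose derivative kills the tangent space of a regular level set are locally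
constant on it.**  Let `H : E → ℝᵖ` be `C¹` with `H a = 0` and surjective derivative at `a`, and
let `G` be differentiable on a neighbourhood `U` of `a` with `DG(x) v = 0` whenever `x ∈ U`,
`H x = 0` and `DH(x) v = 0`.  Then `G x = G a` for all `x` near `a` with `H x = 0`.
(Wilkie 1989, §2, p. 390, over `ℝ`: by the implicit function theorem the zero set of `H` near
`a` is parametrized by a differentiable map `Γ` on a ball of `ker DH(a)`, `G ∘ Γ` has zero
derivative there, hence is constant.) [cite: Wilkie1989, §2, p. 390] -/
theorem eventually_eq_of_fderiv_comp_ker (H : E → Fin p → ℝ) (hH : ContDiff ℝ 1 H) (G : E → ℝ)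
    (a : E) (ha : H a = 0) (hsurj : (fderiv ℝ H a).range = ⊤) {U : Set E} (hU : U ∈ 𝓝 a)
    (hG : ∀ x ∈ U, DifferentiableAt ℝ G x)
    (hdep : ∀ x ∈ U, H x = 0 → ∀ v, fderiv ℝ H x v = 0 → fderiv ℝ G x v = 0) :
    ∀ᶠ x in 𝓝 a, H x = 0 → G x = G a := by
  set H' : E →L[ℝ] (Fin p → ℝ) := fderiv ℝ H a with hH'
  have hHa : HasStrictFDerivAt H H' a := hH.contDiffAt.hasStrictFDerivAt (by simp)
  have hker : H'.ker.ClosedComplemented := H'.ker_closedComplemented_of_finiteDimensional_range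
  set φ : ImplicitFunctionData ℝ E (Fin p → ℝ) H'.ker :=
    HasStrictFDerivAt.implicitFunctionDataOfComplemented H H' hHa hsurj hker with hφ
  have hleft : φ.leftFun = H := rfl
  have hpt : φ.pt = a := rfl
  have hright0 : φ.rightFun a = 0 := by simp [φ]
  have hprod : φ.prodFun φ.pt = (0, 0) := by
    rw [ImplicitFunctionData.prodFun_apply, hpt, hleft, ha, hright0]
  -- the parametrization `Γ` of the zero set near `a`
  set Γ : H'.ker → E := fun z => φ.implicitFunction 0 z with hΓ
  have hΓ0 : Γ 0 = a := by
    have h1 := φ.implicitFunction_apply_image.self_of_nhds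
    rw [hpt, hleft, ha, hright0] at h1
    exact h1
  -- `H ∘ Γ = 0` near `0`
  have hHΓ : ∀ᶠ z in 𝓝 (0 : H'.ker), H (Γ z) = 0 := by
    have h1 := φ.prodFun_implicitFunction
    rw [hprod] at h1
    have hcont : Continuous fun z : H'.ker => ((0 : Fin p → ℝ), z) := by fun_prop
    have h2 := hcont.continuousAt.eventually (show ∀ᶠ q in 𝓝 ((0 : Fin p → ℝ), (0 : H'.ker)),
      φ.prodFun (φ.implicitFunction q.1 q.2) = q from by simpa using h1)
    filter_upwards [h2] with z hz
    have := congrArg Prod.fst hz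
    simpa [ImplicitFunctionData.prodFun_apply, hleft] using this
  -- `Γ` is differentiable near `0`
  have hΓdiff : ∀ᶠ z in 𝓝 (0 : H'.ker), DifferentiableAt ℝ Γ z := by
    have hc : ContDiffAt ℝ 1 φ.implicitFunction.uncurry (φ.prodFun φ.pt) := by
      refine φ.contDiffAt_implicitFunction ?_ ?_ one_ne_zero
      · rw [hleft]; exact hH.contDiffAt
      · show ContDiffAt ℝ 1 (fun x => Classical.choose hker (x - a)) a
        fun_prop
    rw [hprod] at hc
    have h1 := hc.eventually (by simp)
    have hcont : Continuous fun z : H'.ker => ((0 : Fin p → ℝ), z) := by fun_prop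
    have h2 := hcont.continuousAt.eventually
      (show ∀ᶠ q in 𝓝 ((0 : Fin p → ℝ), (0 : H'.ker)), ContDiffAt ℝ 1 φ.implicitFunction.uncurry q
        from by simpa using h1)
    filter_upwards [h2] with z hz
    have hd : DifferentiableAt ℝ φ.implicitFunction.uncurry ((0 : Fin p → ℝ), z) :=
      hz.differentiableAt (by simp)
    exact hd.comp z (by fun_prop)
  -- `Γ z ∈ U` near `0`
  have hΓU : ∀ᶠ z in 𝓝 (0 : H'.ker), Γ z ∈ U := by
    have hcont : ContinuousAt Γ 0 := (hΓdiff.self_of_nhds).continuousAt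
    rw [ContinuousAt, hΓ0] at hcont
    exact hcont hU
  -- a ball on which all of this holds
  obtain ⟨r, hr, hball⟩ : ∃ r > 0, ∀ z : H'.ker, z ∈ Metric.ball (0 : H'.ker) r →
      (∀ᶠ w in 𝓝 z, H (Γ w) = 0) ∧ DifferentiableAt ℝ Γ z ∧ Γ z ∈ U := by
    have h := (eventually_eventually_nhds.2 hHΓ).and (hΓdiff.and hΓU)
    obtain ⟨r, hr, h⟩ := Metric.eventually_nhds_iff_ball.1 h
    exact ⟨r, hr, fun z hz => h z hz⟩
  -- `G ∘ Γ` has zero derivative on the ball, hence is constant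
  have hderiv : ∀ z ∈ Metric.ball (0 : H'.ker) r, fderiv ℝ (G ∘ Γ) z = 0 := by
    intro z hz
    obtain ⟨hHz, hdz, hUz⟩ := hball z hz
    have hHΓ' : fderiv ℝ (H ∘ Γ) z = 0 := by
      have : (H ∘ Γ) =ᶠ[𝓝 z] fun _ => 0 := hHz.mono fun w hw => hw
      rw [this.fderiv_eq, fderiv_const_apply]
    have hchainH : fderiv ℝ (H ∘ Γ) z = (fderiv ℝ H (Γ z)).comp (fderiv ℝ Γ z) :=
      fderiv_comp z (hH.differentiable (by simp) _) hdz
    have hchainG : fderiv ℝ (G ∘ Γ) z = (fderiv ℝ G (Γ z)).comp (fderiv ℝ Γ z) :=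
      fderiv_comp z (hG _ hUz) hdz
    rw [hchainG]
    ext w
    simp only [ContinuousLinearMap.comp_apply, zero_apply]
    refine hdep _ hUz hHz.self_of_nhds _ ?_
    have := congrArg (fun L : H'.ker →L[ℝ] (Fin p → ℝ) => L w) (hchainH.symm.trans hHΓ')
    simpa using this
  have hconst : ∀ z ∈ Metric.ball (0 : H'.ker) r, G (Γ z) = G a := by
    intro z hz
    have hdiffon : DifferentiableOn ℝ (G ∘ Γ) (Metric.ball 0 r) := fun w hw =>
      ((hG _ (hball w hw).2.2).comp w (hball w hw).2.1).differentiableWithinAt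
    have := (convex_ball (0 : H'.ker) r).is_const_of_fderivWithin_eq_zero hdiffon
      (fun w hw => by
        rw [fderivWithin_of_isOpen Metric.isOpen_ball hw]
        exact hderiv w hw) hz (Metric.mem_ball_self hr)
    simpa [hΓ0] using this
  -- every zero of `H` near `a` is `Γ` of a small kernel element
  have hright : ContinuousAt φ.rightFun a := φ.hasStrictFDerivAt_rightFun.continuousAt
  have hsmall : ∀ᶠ x in 𝓝 a, φ.rightFun x ∈ Metric.ball (0 : H'.ker) r := by
    have : Metric.ball (0 : H'.ker) r ∈ 𝓝 (φ.rightFun a) := by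
      rw [hright0]; exact Metric.ball_mem_nhds _ hr
    exact hright this
  have himage := φ.implicitFunction_apply_image
  rw [hpt] at himage
  filter_upwards [hsmall, himage] with x hx1 hx2 hHx
  rw [hleft, hHx] at hx2
  -- `x = Γ (rightFun x)`
  have : G (Γ (φ.rightFun x)) = G a := hconst _ hx1
  rwa [show Γ (φ.rightFun x) = x from hx2] at this

end Real

namespace RealExpModel

/-! ### Balls `Σ (xⱼ - βⱼ)² < ε` in `ℝⁿ` -/

section Balls

variable {n : ℕ}

/-- The ball `Σ (xⱼ - βⱼ)² < ε` (`ε > 0`) is a neighbourhood of `β` in `ℝⁿ`. [folklore] -/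
theorem sqBall_mem_nhds (β : Fin n → ℝ) {ε : ℝ} (hε : 0 < ε) :
    {x : Fin n → ℝ | ∑ j, (x j - β j) ^ 2 < ε} ∈ 𝓝 β := by
  refine (isOpen_lt (by fun_prop) continuous_const).mem_nhds ?_
  simpa using hε

/-- Every neighbourhood of `β` in `ℝⁿ` contains a ball `Σ (xⱼ - βⱼ)² < ε`. [folklore] -/
theorem exists_sqBall_subset {β : Fin n → ℝ} {s : Set (Fin n → ℝ)} (hs : s ∈ 𝓝 β) :
    ∃ ε > 0, ∀ x : Fin n → ℝ, ∑ j, (x j - β j) ^ 2 < ε → x ∈ s := by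
  obtain ⟨δ, hδ, hball⟩ := Metric.mem_nhds_iff.1 hs
  refine ⟨δ ^ 2, by positivity, fun x hx => hball ?_⟩
  rw [Metric.mem_ball, dist_pi_lt_iff hδ]
  intro j
  rw [Real.dist_eq]
  have hj : (x j - β j) ^ 2 < δ ^ 2 :=
    lt_of_le_of_lt (Finset.single_le_sum (fun i _ => sq_nonneg (x i - β i)) (Finset.mem_univ j)) hx
  exact abs_lt_of_sq_lt_sq hj hδ.le

end Balls

/-! ### Gradient rows and Fréchet derivatives of term functions on `ℝⁿ` -/

section RealGrad

variable {κ : Type} {n p : ℕ}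

/-- The Fréchet derivative of a term function is the pairing with its gradient row. [folklore] -/
theorem fderiv_realize_apply (t : Language.orderedExpRing.Term (κ ⊕ Fin n)) (c : κ → ℝ)
    (x v : Fin n → ℝ) :
    fderiv ℝ (fun x : Fin n → ℝ => t.realize (Sum.elim c x)) x v = ∑ j, v j * grad t c x j := by
  classical
  have h := LinearMap.pi_apply_eq_sum_univ
    ((fderiv ℝ (fun x : Fin n → ℝ => t.realize (Sum.elim c x)) x).toLinearMap) v
  simp only [ContinuousLinearMap.coe_coe] at h
  rw [h]
  refine Finset.sum_congr rfl fun j _ => ?_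
  have e : (fun k => if j = k then (1 : ℝ) else 0) = Pi.single j 1 := by
    funext k
    rw [Pi.single_apply]
    split_ifs with h1 h2 h2
    · rfl
    · exact (h2 h1.symm).elim
    · exact (h1 h2.symm).elim
    · rfl
  rw [e, fderiv_realize_single, grad_apply, smul_eq_mul]

/-- The vector function `x ↦ (h₁(x), …, hₚ(x))` of a system of terms. [folklore] -/
def sysFun (h : Fin p → Language.orderedExpRing.Term (κ ⊕ Fin n)) (c : κ → ℝ) :
    (Fin n → ℝ) → Fin p → ℝ :=
  fun x r => (h r).realize (Sum.elim c x)

/-- The system function is smooth. [folklore] -/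
theorem contDiff_sysFun (h : Fin p → Language.orderedExpRing.Term (κ ⊕ Fin n)) (c : κ → ℝ)
    {m : WithTop ℕ∞} : ContDiff ℝ m (sysFun h c) :=
  contDiff_pi.2 fun r => contDiff_realize (h r) c

/-- The derivative of the system function is multiplication by the Jacobian matrix. [folklore] -/
theorem fderiv_sysFun_apply (h : Fin p → Language.orderedExpRing.Term (κ ⊕ Fin n)) (c : κ → ℝ)
    (x v : Fin n → ℝ) :
    fderiv ℝ (sysFun h c) x v = (Matrix.of fun r => grad (h r) c x).mulVec v := by
  have hd : ∀ r, DifferentiableAt ℝ (fun x : Fin n → ℝ => (h r).realize (Sum.elim c x)) x :=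
    fun r => ((contDiff_realize (h r) c (n := 1)).differentiable (by simp)) x
  have : sysFun h c = fun x r => (h r).realize (Sum.elim c x) := rfl
  rw [this, fderiv_pi hd]
  funext r
  rw [ContinuousLinearMap.pi_apply, fderiv_realize_apply, Matrix.mulVec, dotProduct]
  simp [Matrix.of_apply, mul_comm]

/-- If the gradient rows are independent, the derivative of the system function is onto.
[folklore] -/
theorem range_fderiv_sysFun_eq_top (h : Fin p → Language.orderedExpRing.Term (κ ⊕ Fin n))
    (c : κ → ℝ) (β : Fin n → ℝ) (hind : LinearIndependent ℝ (fun r => grad (h r) c β)) :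
    (fderiv ℝ (sysFun h c) β).range = ⊤ := by
  set A : Matrix (Fin p) (Fin n) ℝ := Matrix.of fun r => grad (h r) c β with hA
  have hlin : (fderiv ℝ (sysFun h c) β : (Fin n → ℝ) →ₗ[ℝ] (Fin p → ℝ)) = A.mulVecLin := by
    apply LinearMap.ext
    intro v
    simp only [ContinuousLinearMap.coe_coe, Matrix.mulVecLin_apply]
    exact fderiv_sysFun_apply h c β v
  have hrank : A.rank = p := by
    have := LinearIndependent.rank_matrix (M := A) hind
    simpa using this
  have hfin : Module.finrank ℝ (LinearMap.range A.mulVecLin) = Module.finrank ℝ (Fin p → ℝ) := by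
    rw [Module.finrank_fin_fun]
    exact hrank
  have htop : LinearMap.range A.mulVecLin = ⊤ := Submodule.eq_top_of_finrank_eq hfin
  rw [← htop, ← hlin]

/-- **§2 over `ℝ`, for exponential terms.**  Let `h₁, …, hₚ, t, a₀` be exponential terms (parameters
`c`), `β ∈ V(h₁, …, hₚ)` with independent gradient rows `∇hᵣ(β)` and `a₀(β) ≠ 0`, and suppose
that on `V(h₁, …, hₚ)` near `β` the row `a₀ ∇t - t ∇a₀` (that is `a₀² ∇(t/a₀)`) lies in the span
of the `∇hᵣ`.  Then `t/a₀` is constant on `V(h₁, …, hₚ)` near `β`: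
`t(x) a₀(β) = t(β) a₀(x)` (Wilkie 1989, §2, p. 390, the case `K = ℝ`). [cite: Wilkie1989, §2, p. 390] -/
theorem real_eqOn_closeTo_of_wedge (h : Fin p → Language.orderedExpRing.Term (κ ⊕ Fin n))
    (t a₀ : Language.orderedExpRing.Term (κ ⊕ Fin n)) (c : κ → ℝ) (β : Fin n → ℝ)
    (hβ : ∀ r, (h r).realize (Sum.elim c β) = 0)
    (hind : LinearIndependent ℝ (fun r => grad (h r) c β))
    (ha₀ : a₀.realize (Sum.elim c β) ≠ 0) {ε : ℝ} (hε : 0 < ε)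
    (hdep : ∀ x : Fin n → ℝ, ∑ j, (x j - β j) ^ 2 < ε → (∀ r, (h r).realize (Sum.elim c x) = 0) →
      (a₀.realize (Sum.elim c x) • grad t c x - t.realize (Sum.elim c x) • grad a₀ c x) ∈
        Submodule.span ℝ (Set.range fun r => grad (h r) c x)) :
    ∃ ε' > 0, ∀ x : Fin n → ℝ, ∑ j, (x j - β j) ^ 2 < ε' →
      (∀ r, (h r).realize (Sum.elim c x) = 0) →
        t.realize (Sum.elim c x) * a₀.realize (Sum.elim c β) =
          t.realize (Sum.elim c β) * a₀.realize (Sum.elim c x) := by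
  -- the functions
  set T : (Fin n → ℝ) → ℝ := fun x => t.realize (Sum.elim c x) with hT
  set A0 : (Fin n → ℝ) → ℝ := fun x => a₀.realize (Sum.elim c x) with hA0
  set G : (Fin n → ℝ) → ℝ := fun x => T x / A0 x with hG
  have hTd : Differentiable ℝ T := (contDiff_realize t c (n := 1)).differentiable (by simp)
  have hA0d : Differentiable ℝ A0 := (contDiff_realize a₀ c (n := 1)).differentiable (by simp)
  -- the neighbourhood `U = {a₀ ≠ 0} ∩ ball`
  set U : Set (Fin n → ℝ) := {x | A0 x ≠ 0} ∩ {x | ∑ j, (x j - β j) ^ 2 < ε} with hU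
  have hUo : IsOpen {x : Fin n → ℝ | A0 x ≠ 0} := isOpen_ne_fun hA0d.continuous continuous_const
  have hUn : U ∈ 𝓝 β := Filter.inter_mem (hUo.mem_nhds ha₀) (sqBall_mem_nhds β hε)
  have hGd : ∀ x ∈ U, DifferentiableAt ℝ G x := fun x hx => (hTd x).mul ((hA0d x).inv hx.1)
  -- the derivative of `G` kills the kernel of the Jacobian on `V ∩ U`
  have hdep' : ∀ x ∈ U, sysFun h c x = 0 → ∀ v, fderiv ℝ (sysFun h c) x v = 0 →
      fderiv ℝ G x v = 0 := by
    intro x hx hVx v hv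
    have hVx' : ∀ r, (h r).realize (Sum.elim c x) = 0 := fun r => congrFun hVx r
    obtain ⟨d, hd⟩ := (Submodule.mem_span_range_iff_exists_fun ℝ).1 (hdep x hx.2 hVx')
    -- `Σ_j v_j (a₀ ∂_j t - t ∂_j a₀)(x) = 0`
    have hv' : ∀ r, ∑ j, v j * grad (h r) c x j = 0 := by
      intro r
      have := congrFun hv r
      rw [fderiv_sysFun_apply] at this
      simpa [Matrix.mulVec, dotProduct, Matrix.of_apply, mul_comm] using this
    have hsum : ∑ j, v j * (A0 x * grad t c x j - T x * grad a₀ c x j) = 0 := by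
      have e1 : ∀ j, A0 x * grad t c x j - T x * grad a₀ c x j = ∑ r, d r * grad (h r) c x j := by
        intro j
        have := congrFun hd j
        simpa [Finset.sum_apply, Pi.smul_apply, smul_eq_mul] using this.symm
      simp_rw [e1, Finset.mul_sum]
      rw [Finset.sum_comm]
      refine Finset.sum_eq_zero fun r _ => ?_
      have := hv' r
      calc (∑ j, v j * (d r * grad (h r) c x j)) = d r * ∑ j, v j * grad (h r) c x j := by
            rw [Finset.mul_sum]; refine Finset.sum_congr rfl fun j _ => ?_; ring
        _ = 0 := by rw [this, mul_zero]
    -- `Dt v = G Da₀ v + a₀ DG v` near `x` (product rule for `t = G · a₀` on `U`)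
    have hloc : T =ᶠ[𝓝 x] fun y => G y * A0 y := by
      filter_upwards [hUo.mem_nhds hx.1] with y hy
      simp only [hG]
      field_simp
    have hprod : fderiv ℝ T x v = G x * fderiv ℝ A0 x v + A0 x * fderiv ℝ G x v := by
      rw [hloc.fderiv_eq, fderiv_fun_mul (hGd x hx) (hA0d x)]
      simp [smul_eq_mul]
    rw [fderiv_realize_apply] at hprod
    have hA0v : fderiv ℝ A0 x v = ∑ j, v j * grad a₀ c x j := fderiv_realize_apply a₀ c x v
    rw [hA0v] at hprod
    -- conclude `a₀² DG v = Σ v_j (a₀ ∂t - t ∂a₀) = 0`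
    have hx0 : A0 x ≠ 0 := hx.1
    have key : A0 x * A0 x * fderiv ℝ G x v =
        ∑ j, v j * (A0 x * grad t c x j - T x * grad a₀ c x j) := by
      have e2 : (∑ j, v j * (A0 x * grad t c x j - T x * grad a₀ c x j)) =
          A0 x * ∑ j, v j * grad t c x j - T x * ∑ j, v j * grad a₀ c x j := by
        rw [Finset.mul_sum, Finset.mul_sum, ← Finset.sum_sub_distrib]
        refine Finset.sum_congr rfl fun j _ => ?_; ring
      rw [e2, hprod]
      simp only [hG]
      field_simp
      ring
    rw [hsum] at key
    have : A0 x * A0 x ≠ 0 := mul_ne_zero hx0 hx0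
    exact (mul_eq_zero.1 key).resolve_left this
  have hcore := Real.eventually_eq_of_fderiv_comp_ker (sysFun h c) (contDiff_sysFun h c) G β
    (funext hβ) (range_fderiv_sysFun_eq_top h c β hind) hUn hGd hdep'
  -- unpack into a ball
  obtain ⟨ε', hε', hball⟩ := exists_sqBall_subset (hcore.and hUn)
  refine ⟨ε', hε', fun x hx hVx => ?_⟩
  obtain ⟨h1, h2⟩ := hball x hx
  have hGx : G x = G β := h1 (funext hVx)
  have hx0 : A0 x ≠ 0 := h2.1
  simp only [hG] at hGx
  rw [div_eq_div_iff hx0 ha₀] at hGx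
  simpa [hT, hA0, mul_comm] using hGx

end RealGrad

/-! ### The first-order formula of §2 and its transfer -/

section Wedge

variable {κ : Type} {n p : ℕ}

/-- The first-order formula expressing `real_eqOn_closeTo_of_wedge` for the terms `h₁, …, hₚ, t,
a₀`, in the free variables: parameters `κ`, the point `β` (`Fin n`) and the radius `ε` (`Fin 1`).
Independence of the rows `∇hᵣ(β)` is expressed by the non-vanishing of some `p × p` minor
(`minorTerm`), and the span condition by the existence of coefficients. [folklore] -/
def wedgeFormula (h : Fin p → Language.orderedExpRing.Term (κ ⊕ Fin n))
    (t a₀ : Language.orderedExpRing.Term (κ ⊕ Fin n)) :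
    Language.orderedExpRing.Formula ((κ ⊕ Fin n) ⊕ Fin 1) :=
  let W := (κ ⊕ Fin n) ⊕ Fin 1
  let atβ : Language.orderedExpRing.Term (κ ⊕ Fin n) → Language.orderedExpRing.Term W :=
    fun s => s.relabel Sum.inl
  let atx : Language.orderedExpRing.Term (κ ⊕ Fin n) →
      Language.orderedExpRing.Term (W ⊕ Fin n) :=
    fun s => s.relabel (Sum.map (Sum.inl ∘ Sum.inl) _root_.id)
  -- ball of radius (the variable) `e : W` around `β`, in the variables `W ⊕ Fin n`
  let ball : Language.orderedExpRing.Term W → Language.orderedExpRing.Formula (W ⊕ Fin n) :=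
    fun e => ExpFormula.lt
      (ExpTerm.sum fun j : Fin n =>
        (var (Sum.inr j) + -var (Sum.inl (Sum.inl (Sum.inr j)))) *
          (var (Sum.inr j) + -var (Sum.inl (Sum.inl (Sum.inr j)))))
      (e.relabel Sum.inl)
  let zeros : Language.orderedExpRing.Formula (W ⊕ Fin n) :=
    Formula.iInf fun r => ExpFormula.eq (atx (h r)) 0
  let hyp₁ : Language.orderedExpRing.Formula W := ExpFormula.lt 0 (var (Sum.inr 0))
  let hyp₂ : Language.orderedExpRing.Formula W := Formula.iInf fun r => ExpFormula.eq (atβ (h r)) 0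
  let hyp₃ : Language.orderedExpRing.Formula W :=
    Formula.iSup fun I : Fin p → Fin n => (ExpFormula.eq (atβ (minorTerm h I)) 0).not
  let hyp₄ : Language.orderedExpRing.Formula W := (ExpFormula.eq (atβ a₀) 0).not
  let dep : Language.orderedExpRing.Formula (W ⊕ Fin n) :=
    Formula.iExs (Fin p)
      (Formula.iInf fun j : Fin n =>
        ExpFormula.eq
          (((atx a₀ * atx (termPDeriv j t) + -(atx t * atx (termPDeriv j a₀))).relabel Sum.inl))
          (ExpTerm.sum fun r : Fin p => var (Sum.inr r) * (atx (termPDeriv j (h r))).relabel Sum.inl))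
  let hyp₅ : Language.orderedExpRing.Formula W :=
    Formula.iAlls (Fin n) ((ball (var (Sum.inr 0)) ⊓ zeros) ⟹ dep)
  let ballC : Language.orderedExpRing.Formula ((W ⊕ Fin 1) ⊕ Fin n) :=
    ExpFormula.lt
      (ExpTerm.sum fun j : Fin n =>
        (var (Sum.inr j) + -var (Sum.inl (Sum.inl (Sum.inl (Sum.inr j))))) *
          (var (Sum.inr j) + -var (Sum.inl (Sum.inl (Sum.inl (Sum.inr j))))))
      (var (Sum.inl (Sum.inr 0)))
  let concl : Language.orderedExpRing.Formula W :=
    Formula.iExs (Fin 1)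
      (ExpFormula.lt 0 (var (Sum.inr 0)) ⊓
        Formula.iAlls (Fin n)
          ((ballC ⊓ zeros.relabel (Sum.map Sum.inl _root_.id)) ⟹
            ExpFormula.eq
              ((atx t).relabel (Sum.map Sum.inl _root_.id) * ((atβ a₀).relabel Sum.inl).relabel Sum.inl)
              (((atβ t).relabel Sum.inl).relabel Sum.inl * (atx a₀).relabel (Sum.map Sum.inl _root_.id))))
  (hyp₁ ⊓ hyp₂ ⊓ hyp₃ ⊓ hyp₄ ⊓ hyp₅) ⟹ concl

/-- Realization of `wedgeFormula` in a lawful structure. [folklore] -/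
theorem realize_wedgeFormula {M : Type*} [Language.orderedExpRing.Structure M] [Field M]
    [LinearOrder M] [LawfulStructure M]
    (h : Fin p → Language.orderedExpRing.Term (κ ⊕ Fin n))
    (t a₀ : Language.orderedExpRing.Term (κ ⊕ Fin n)) (v : (κ ⊕ Fin n) ⊕ Fin 1 → M) :
    (wedgeFormula h t a₀).Realize v ↔
      ((0 < v (Sum.inr 0) ∧
        (∀ r, (h r).realize (v ∘ Sum.inl) = 0) ∧
        (∃ I : Fin p → Fin n, (minorTerm h I).realize (v ∘ Sum.inl) ≠ 0) ∧
        a₀.realize (v ∘ Sum.inl) ≠ 0 ∧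
        ∀ x : Fin n → M,
          ((∑ j, (x j + -v (Sum.inl (Sum.inr j))) * (x j + -v (Sum.inl (Sum.inr j))) <
                v (Sum.inr 0)) ∧
            ∀ r, (h r).realize (Sum.elim (fun c => v (Sum.inl (Sum.inl c))) x) = 0) →
          ∃ d : Fin p → M, ∀ j : Fin n,
            a₀.realize (Sum.elim (fun c => v (Sum.inl (Sum.inl c))) x) *
                (termPDeriv j t).realize (Sum.elim (fun c => v (Sum.inl (Sum.inl c))) x) +
              -((t.realize (Sum.elim (fun c => v (Sum.inl (Sum.inl c))) x)) *
                (termPDeriv j a₀).realize (Sum.elim (fun c => v (Sum.inl (Sum.inl c))) x)) =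
            ∑ r, d r * (termPDeriv j (h r)).realize (Sum.elim (fun c => v (Sum.inl (Sum.inl c))) x)) →
      ∃ e : Fin 1 → M, 0 < e 0 ∧ ∀ x : Fin n → M,
        ((∑ j, (x j + -v (Sum.inl (Sum.inr j))) * (x j + -v (Sum.inl (Sum.inr j))) < e 0) ∧
          ∀ r, (h r).realize (Sum.elim (fun c => v (Sum.inl (Sum.inl c))) x) = 0) →
        t.realize (Sum.elim (fun c => v (Sum.inl (Sum.inl c))) x) * a₀.realize (v ∘ Sum.inl) =
          t.realize (v ∘ Sum.inl) * a₀.realize (Sum.elim (fun c => v (Sum.inl (Sum.inl c))) x)) := by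
  have e1 : ∀ (x : Fin n → M),
      ((fun a => Sum.elim v x a) ∘ Sum.map (Sum.inl ∘ Sum.inl) _root_.id :
          κ ⊕ Fin n → M) = Sum.elim (fun c => v (Sum.inl (Sum.inl c))) x := by
    intro x
    funext a
    rcases a with a | a <;> rfl
  simp only [wedgeFormula, Formula.realize_imp, Formula.realize_inf, Formula.realize_iInf,
    Formula.realize_iSup, Formula.realize_iAlls, Formula.realize_iExs, Formula.realize_not,
    Formula.realize_relabel, ExpFormula.realize_lt, ExpFormula.realize_eq,
    ExpTerm.realize_zero, ExpTerm.realize_sum, ExpTerm.realize_mul, ExpTerm.realize_add,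
    ExpTerm.realize_neg, Term.realize_var, Term.realize_relabel, Sum.elim_comp_inl, Sum.elim_inr,
    Sum.elim_inl, e1, and_assoc, Function.comp_id, Sum.elim_comp_map, ne_eq]

/-- `wedgeFormula` holds in `ℝ` (from `real_eqOn_closeTo_of_wedge`). [folklore] -/
theorem realize_wedgeFormula_real (h : Fin p → Language.orderedExpRing.Term (κ ⊕ Fin n))
    (t a₀ : Language.orderedExpRing.Term (κ ⊕ Fin n)) (v : (κ ⊕ Fin n) ⊕ Fin 1 → ℝ) :
    (wedgeFormula h t a₀).Realize v := by
  rw [realize_wedgeFormula]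
  rintro ⟨hε, hV, ⟨I, hI⟩, ha₀, hdep⟩
  set c : κ → ℝ := fun x => v (Sum.inl (Sum.inl x)) with hc
  set β : Fin n → ℝ := fun j => v (Sum.inl (Sum.inr j)) with hβdef
  have hva : v ∘ Sum.inl = Sum.elim c β := by
    funext x; rcases x with x | j <;> rfl
  rw [hva] at hV hI ha₀ ⊢
  have hind : LinearIndependent ℝ (fun r => grad (h r) c β) := by
    rw [realize_minorTerm] at hI
    exact linearIndependent_rows_of_det_submatrix_ne_zero (Matrix.of fun r => grad (h r) c β) I hI
  have hdep' : ∀ x : Fin n → ℝ, ∑ j, (x j - β j) ^ 2 < v (Sum.inr 0) →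
      (∀ r, (h r).realize (Sum.elim c x) = 0) →
        (a₀.realize (Sum.elim c x) • grad t c x - t.realize (Sum.elim c x) • grad a₀ c x) ∈
          Submodule.span ℝ (Set.range fun r => grad (h r) c x) := by
    intro x hx hVx
    obtain ⟨d, hd⟩ := hdep x ⟨by simpa [sq, sub_eq_add_neg] using hx, hVx⟩
    rw [Submodule.mem_span_range_iff_exists_fun]
    refine ⟨d, ?_⟩
    funext j
    have := hd j
    simp only [Finset.sum_apply, Pi.smul_apply, smul_eq_mul, Pi.sub_apply, grad_apply]
    rw [← sub_eq_add_neg] at this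
    rw [this]
  obtain ⟨ε', hε', H⟩ := real_eqOn_closeTo_of_wedge h t a₀ c β hV hind ha₀ hε hdep'
  refine ⟨fun _ => ε', hε', fun x hx => ?_⟩
  exact H x (by simpa [sq, sub_eq_add_neg] using hx.1) hx.2

/-- **Wilkie 1989, §2, in the models of `T_exp` (proved by transfer).**  Let `K ⊨ T_exp`, let
`h₁, …, hₚ, t, a₀` be exponential terms with parameters from `K`, `β ∈ V(h₁, …, hₚ)` with
`(dh₁ ∧ ⋯ ∧ dhₚ)(β) ≠ 0` (independent gradient rows) and `a₀(β) ≠ 0`, and suppose that on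
`V(h₁, …, hₚ)` close to `β` the row `a₀ ∇t - t ∇a₀ = a₀² ∇(t/a₀)` lies in the span of the `∇hᵣ`
(i.e. `(dh₁ ∧ ⋯ ∧ dhₚ ∧ d(t/a₀)) = 0` there).  Then `t/a₀` is constant on `V(h₁, …, hₚ)` close to
`β` (p. 390: "if the `(p+1)`-form `df₁ ∧ ⋯ ∧ dfₚ ∧ dg` vanishes on `(U × U') ∩ {γ̄ : fᵢ(γ̄) = 0}`
then `g` is constant on this set"). [cite: Wilkie1989, §2, p. 390] -/
theorem eqOn_closeTo_of_wedge_vanishes (K : Language.Theory.ModelType.{0, 0, 0} realExpTheory)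
    (a : κ → K) (h : Fin p → Language.orderedExpRing.Term (κ ⊕ Fin n))
    (t a₀ : Language.orderedExpRing.Term (κ ⊕ Fin n)) (β : Fin n → K) (hβ : β ∈ zeroSet h a)
    (hind : LinearIndependent K (fun r => grad (h r) a β)) (ha₀ : a₀.realize (Sum.elim a β) ≠ 0)
    {ε : K} (hε : 0 < ε)
    (hdep : ∀ x : Fin n → K, ∑ j, (x j - β j) ^ 2 < ε → x ∈ zeroSet h a →
      (a₀.realize (Sum.elim a x) • grad t a x - t.realize (Sum.elim a x) • grad a₀ a x) ∈
        Submodule.span K (Set.range fun r => grad (h r) a x)) :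
    ∃ ε' : K, 0 < ε' ∧ ∀ x : Fin n → K, ∑ j, (x j - β j) ^ 2 < ε' → x ∈ zeroSet h a →
      t.realize (Sum.elim a x) * a₀.realize (Sum.elim a β) =
        t.realize (Sum.elim a β) * a₀.realize (Sum.elim a x) := by
  have H := realize_formula_of_real K (wedgeFormula h t a₀) (realize_wedgeFormula_real h t a₀)
    (Sum.elim (Sum.elim a β) fun _ => ε)
  rw [realize_wedgeFormula] at H
  simp only [Sum.elim_comp_inl, Sum.elim_inr, Sum.elim_inl] at H
  obtain ⟨I, -, hI⟩ := exists_det_submatrix_ne_zero_of_linearIndependent_rows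
    (Matrix.of fun r => grad (h r) a β) hind
  have hdep' : ∀ x : Fin n → K,
      ((∑ j, (x j + -β j) * (x j + -β j) < ε) ∧ ∀ r, (h r).realize (Sum.elim a x) = 0) →
        ∃ d : Fin p → K, ∀ j : Fin n,
          a₀.realize (Sum.elim a x) * (termPDeriv j t).realize (Sum.elim a x) +
            -(t.realize (Sum.elim a x) * (termPDeriv j a₀).realize (Sum.elim a x)) =
          ∑ r, d r * (termPDeriv j (h r)).realize (Sum.elim a x) := by
    rintro x ⟨hx, hVx⟩
    obtain ⟨d, hd⟩ := (Submodule.mem_span_range_iff_exists_fun K).1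
      (hdep x (by simpa [sq, sub_eq_add_neg] using hx) hVx)
    refine ⟨d, fun j => ?_⟩
    have := congrFun hd j
    simp only [Finset.sum_apply, Pi.smul_apply, smul_eq_mul, Pi.sub_apply, grad_apply] at this
    rw [← sub_eq_add_neg, ← this]
  obtain ⟨e, he, H'⟩ := H ⟨hε, hβ, ⟨I, by rw [realize_minorTerm]; exact hI⟩, ha₀, hdep'⟩
  refine ⟨e 0, he, fun x hx hVx => H' x ⟨by simpa [sq, sub_eq_add_neg] using hx, hVx⟩⟩

/-- **Corollary** (the form used in the proof of Lemma 1, p. 394: "`ω ∧ d(h · a₀⁻¹)` is defined and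
vanishes on `V(h₁, …, hₚ)` close to `β̄`. However … this implies that `h · a₀⁻¹` is constant,
hence `0`, on `V(h₁, …, hₚ)` close to `β̄`"): if moreover `t(β) = 0` then `t` vanishes on
`V(h₁, …, hₚ)` close to `β`. [cite: Wilkie1989, §2, p. 390 and p. 394] -/
theorem vanishesCloseTo_of_wedge_vanishes (K : Language.Theory.ModelType.{0, 0, 0} realExpTheory)
    (a : κ → K) (h : Fin p → Language.orderedExpRing.Term (κ ⊕ Fin n))
    (t a₀ : Language.orderedExpRing.Term (κ ⊕ Fin n)) (β : Fin n → K) (hβ : β ∈ zeroSet h a)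
    (hind : LinearIndependent K (fun r => grad (h r) a β)) (ha₀ : a₀.realize (Sum.elim a β) ≠ 0)
    (ht : t.realize (Sum.elim a β) = 0) {ε : K} (hε : 0 < ε)
    (hdep : ∀ x : Fin n → K, ∑ j, (x j - β j) ^ 2 < ε → x ∈ zeroSet h a →
      (a₀.realize (Sum.elim a x) • grad t a x - t.realize (Sum.elim a x) • grad a₀ a x) ∈
        Submodule.span K (Set.range fun r => grad (h r) a x)) :
    VanishesCloseTo t h a β := by
  obtain ⟨ε', hε', H⟩ := eqOn_closeTo_of_wedge_vanishes K a h t a₀ β hβ hind ha₀ hε hdep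
  refine ⟨ε', hε', fun x hx hVx => ?_⟩
  have := H x hx hVx
  rw [ht, zero_mul] at this
  exact (mul_eq_zero.1 this).resolve_right ha₀

end Wedge

/-! ### The converse at the point: vanishing near `β` forces `(dh₁ ∧ ⋯ ∧ dhₚ ∧ dt)(β) = 0` -/

section Converse

variable {κ : Type} {n p : ℕ}

/-- **Wilkie 1989, §2, converse direction at the point** (p. 390 "and conversely"; used on p. 393):
if `t` vanishes on `V(h₁, …, hₚ)` close to `β ∈ V(h₁, …, hₚ)`, then the gradient rows
`∇t(β), ∇h₁(β), …, ∇hₚ(β)` are linearly dependent, i.e. `(dh₁ ∧ ⋯ ∧ dhₚ ∧ dt)(β) = 0`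
(`β` is a local minimum of `t` on the zero set; Lagrange multipliers by transfer). [cite: Wilkie1989, §2, p. 390] -/
theorem not_linearIndependent_of_vanishesCloseTo
    (K : Language.Theory.ModelType.{0, 0, 0} realExpTheory) (a : κ → K)
    (h : Fin p → Language.orderedExpRing.Term (κ ⊕ Fin n)) (t : Language.orderedExpRing.Term (κ ⊕ Fin n))
    (β : Fin n → K) (hβ : β ∈ zeroSet h a) (ht : VanishesCloseTo t h a β) :
    ¬ LinearIndependent K (gradRows h t a β) := by
  obtain ⟨ε, hε, H⟩ := ht
  have hβ0 : t.realize (Sum.elim a β) = 0 := H β (by simpa using hε) hβ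
  refine not_linearIndependent_gradRows_of_isLocalMin K a h t β hβ hε fun x hx hVx => ?_
  rw [hβ0, H x hx hVx]

end Converse

/-! ### Continuity, by transfer -/

section Continuity

variable {κ : Type} {n : ℕ}

/-- The formula "if `t(β) ≠ 0` then `t ≠ 0` on a ball around `β`" (free variables: parameters and
`β`). [folklore] -/
def neZeroBallFormula (t : Language.orderedExpRing.Term (κ ⊕ Fin n)) :
    Language.orderedExpRing.Formula (κ ⊕ Fin n) :=
  (ExpFormula.eq t 0).not ⟹
    Formula.iExs (Fin 1)
      (ExpFormula.lt 0 (var (Sum.inr 0)) ⊓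
        Formula.iAlls (Fin n)
          (ExpFormula.lt
              (ExpTerm.sum fun j : Fin n =>
                (var (Sum.inr j) + -var (Sum.inl (Sum.inl (Sum.inr j)))) *
                  (var (Sum.inr j) + -var (Sum.inl (Sum.inl (Sum.inr j)))))
              (var (Sum.inl (Sum.inr 0))) ⟹
            (ExpFormula.eq (t.relabel (Sum.map (Sum.inl ∘ Sum.inl) _root_.id)) 0).not))

/-- Realization of `neZeroBallFormula`. [folklore] -/
theorem realize_neZeroBallFormula {M : Type*} [Language.orderedExpRing.Structure M] [Field M]
    [LinearOrder M] [LawfulStructure M] (t : Language.orderedExpRing.Term (κ ⊕ Fin n))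
    (c : κ → M) (β : Fin n → M) :
    (neZeroBallFormula t).Realize (Sum.elim c β) ↔
      (t.realize (Sum.elim c β) ≠ 0 → ∃ e : Fin 1 → M, 0 < e 0 ∧ ∀ x : Fin n → M,
        (∑ j, (x j + -β j) * (x j + -β j) < e 0) → t.realize (Sum.elim c x) ≠ 0) := by
  have e1 : ∀ (e : Fin 1 → M) (x : Fin n → M),
      ((fun a => Sum.elim (fun a => Sum.elim (Sum.elim c β) e a) x a) ∘
          Sum.map (Sum.inl ∘ Sum.inl) _root_.id : κ ⊕ Fin n → M) = Sum.elim c x := by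
    intro e x
    funext a
    rcases a with a | a <;> rfl
  simp only [neZeroBallFormula, Formula.realize_imp, Formula.realize_inf, Formula.realize_iAlls,
    Formula.realize_iExs, Formula.realize_not, ExpFormula.realize_lt, ExpFormula.realize_eq,
    ExpTerm.realize_zero, ExpTerm.realize_sum, ExpTerm.realize_mul, ExpTerm.realize_add,
    ExpTerm.realize_neg, Term.realize_var, Term.realize_relabel, Sum.elim_inr, Sum.elim_inl, e1,
    ne_eq]

/-- **Continuity by transfer** (Wilkie 1989, p. 393: "`aₛ(β̄') ≠ 0` and hence (by transfer) `aₛ` is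
non-zero throughout some sufficiently small neighbourhood of `β̄'`"): in a model of `T_exp`, a
term nonzero at `β` is nonzero on a ball around `β`. [cite: Wilkie1989, §3, p. 393] -/
theorem exists_ball_ne_zero (K : Language.Theory.ModelType.{0, 0, 0} realExpTheory) (a : κ → K)
    (t : Language.orderedExpRing.Term (κ ⊕ Fin n)) (β : Fin n → K)
    (ht : t.realize (Sum.elim a β) ≠ 0) :
    ∃ ε : K, 0 < ε ∧ ∀ x : Fin n → K, ∑ j, (x j - β j) ^ 2 < ε → t.realize (Sum.elim a x) ≠ 0 := by
  have hreal : ∀ v : κ ⊕ Fin n → ℝ, (neZeroBallFormula t).Realize v := by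
    intro v
    rw [← Sum.elim_comp_inl_inr v, realize_neZeroBallFormula]
    intro hne
    have hopen : IsOpen {x : Fin n → ℝ | t.realize (Sum.elim (v ∘ Sum.inl) x) ≠ 0} :=
      isOpen_ne_fun (continuous_realize t _) continuous_const
    obtain ⟨ε, hε, hball⟩ := exists_sqBall_subset (hopen.mem_nhds hne)
    exact ⟨fun _ => ε, hε, fun x hx => hball x (by simpa [sq, sub_eq_add_neg] using hx)⟩
  have H := realize_formula_of_real K (neZeroBallFormula t) hreal (Sum.elim a β)
  rw [realize_neZeroBallFormula] at H
  obtain ⟨e, he, H'⟩ := H ht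
  exact ⟨e 0, he, fun x hx => H' x (by simpa [sq, sub_eq_add_neg] using hx)⟩

end Continuity

/-! ### `∂/∂xᵢ` respects equality of term functions (p. 385), by transfer -/

section DerivCongr

variable {κ : Type} {n : ℕ}

/-- The formula "if `t₁ = t₂` as functions of `x̄` then `∂t₁/∂xᵢ = ∂t₂/∂xᵢ` as functions of `x̄`"
(free variables: the parameters). [folklore] -/
def derivCongrFormula (i : Fin n) (t₁ t₂ : Language.orderedExpRing.Term (κ ⊕ Fin n)) :
    Language.orderedExpRing.Formula κ :=
  Formula.iAlls (Fin n) (ExpFormula.eq t₁ t₂) ⟹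
    Formula.iAlls (Fin n) (ExpFormula.eq (termPDeriv i t₁) (termPDeriv i t₂))

/-- **`∂/∂xᵢ` respects the equivalence of terms** (Wilkie 1989, p. 385: "It can be shown (see [4])
that `∂/∂xᵢ` respects the equivalence relation"), in the semantic form used here: in a model `K`
of `T_exp`, if two terms (with parameters) define the same function on `Kⁿ` then so do their
formal partial derivatives (true in `ℝ`, where the formal derivative is the derivative; then by
transfer). [cite: Wilkie1989, §1, p. 385] -/
theorem realize_termPDeriv_congr (K : Language.Theory.ModelType.{0, 0, 0} realExpTheory)
    (a : κ → K) (i : Fin n) (t₁ t₂ : Language.orderedExpRing.Term (κ ⊕ Fin n))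
    (h : ∀ x : Fin n → K, t₁.realize (Sum.elim a x) = t₂.realize (Sum.elim a x))
    (x : Fin n → K) :
    (termPDeriv i t₁).realize (Sum.elim a x) = (termPDeriv i t₂).realize (Sum.elim a x) := by
  have hreal : ∀ v : κ → ℝ, (derivCongrFormula i t₁ t₂).Realize v := by
    intro v
    simp only [derivCongrFormula, Formula.realize_imp, Formula.realize_iAlls, ExpFormula.realize_eq]
    intro H y
    have hfun : (fun y : Fin n → ℝ => t₁.realize (Sum.elim v y)) =
        fun y => t₂.realize (Sum.elim v y) := funext fun y => H y
    rw [← fderiv_realize_single, ← fderiv_realize_single, hfun]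
  have H := realize_formula_of_real K (derivCongrFormula i t₁ t₂) hreal a
  simp only [derivCongrFormula, Formula.realize_imp, Formula.realize_iAlls, ExpFormula.realize_eq]
    at H
  exact H h x

end DerivCongr

end RealExpModel

end Literature.ModelTheory.ExponentialFields
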